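import Literature.MathematicalPhysics.QuantumFieldTheory.Balaban1983to89.Beta.OneStepKernelFamily

/-!
# Inter-level transport: coarse-indexed superpositions, response transport of vertex families one blocking level up,
# and the inter-level LIFT of a step kernel onto the multiplier legs of the finer packed resolvent
# VERSIONS: v1 = p188335 commit a27a78666500 (§1–§4: declarations unchanged below; header docfix only — the verbatim ABSOLUTE
# RULE paragraph (beta-ref A-R371 / lit2 XREAD C-lit2g18-4 D2) and the CONTENT name `decays_lift` (D1)); v1.1 (this file,
# APPEND-ONLY): §5 the AVERAGING LIFT `avgLift M G = Q′ᵀ G Q′` (transpose partner of `OneStepKernelFamily.dec = Q′ K Q′ᵀ`), its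
# bi-localisation, the ADJOINTNESS `tadpole K (avgLift M G) = tadpole (dec M K) G` and the SANDWICH identity
# `dec M (K · avgLift M V · K′) = dec M K · V · dec M K′`; §6 the WEIGHTED lift `liftW` (one unit factor `M^(d+2)` per field slot).

HONEST FRAMING (page 1).  Discharging `FlowStep.BetaPertH` would make Bałaban's ultraviolet stability UNCONDITIONAL — a real
constructive-QFT result; it is NOT the continuum limit and NOT the Clay problem.  This file discharges nothing of `BetaPertH` and
asserts nothing about Bałaban's kernels: it is ELEMENTARY KERNEL CALCULUS over the sockets of `Beta/ExpKernelCalculus` and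
`Beta/OneStepResolventKernel` (extension by zero from a sublattice, re-indexed `tsum`s, the `wsum` superposition bounds with one
more use of the triangle inequality, finite sums over directions).  No colour weight, no value of `N`, nothing from B9/B12 is
asserted: every kernel, weight and response below is an ABSTRACT PARAMETER with stated decay hypotheses.

ABSOLUTE RULE (cell charter, verbatim; header paragraph added v1.1 per beta-ref advisory A-R371, docstring-only): «No
internally-minted statement may enter as a cited fact. Every hypothesis is either kernel-proved in this package or a
verbatim quotation of a PUBLISHED theorem with page reference. The manuscript(s) under audit are NOT citable for their
own disputed steps — they are the thing under adjudication; programme-internal (2001/route/tribunal) claims are never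
citable.»  Accordingly NO declaration below is a `def … : Prop` carrying a citation and no hypothesis of any theorem is
a printed statement: every declaration is [folklore]; the single B12 tag below is an object LOCATOR only.

WHY (DESIGN (D-μ) of the β sub-cell's an2 lineage, gen 8).  In the one-loop drift chain `D1Tel → D1Rep → D1Drift`
(`Beta/OneStepKernelFamily` §3, §10) the composite ("one-shot") jet data `Jc m : JetData d (Lc^m)` of the `m`-fold blocking are
DEFINED from Bałaban's step jet data `Js` by the chain rule of the composition of renormalization transformations (B12 (1.20)–(1.22),
p. 264: the vacuum-polarization tensor «of the theory defined by the j-th fluctuation field integral» telescopes over the steps).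
Typing that recursion needs three operations this file supplies ONCE, generically, with their localisation and covariance lemmas:
(i) superpositions `Σ_y w y • Q y` of kernels indexed by the points `y` of a COARSER lattice but living on the fine one (`cwsum`);
(ii) the transport of a first- / second-order vertex family through the RESPONSE KERNEL of the next blocking step — the chain rule
`∂_{B(μ,z)} = Σ_{(μ′,y′)} R(μ′,y′ ← μ,z) ∂_{V(μ′,y′)}` (`transportV`, `transportW`; for Bałaban's data `R` is the step minimiser
`colH (KInvStep Lc j) Lc`, here abstract); (iii) the LIFT of a block of a kernel written in coarse coordinates onto the fine lattice's
multiplier legs (`lift`), over which the kernel-level KKT composition identities of the packed resolvents (the interface of the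
DELEGATED telescoping node P6, journal l.52886) are stated elsewhere.  The abstract multiplier-curvature stencil `SLam` (the first jet of
the Lagrange term `−Λ·Q″` of the bordered Hessian, (D-λ)) is the first consumer of (i).

CONTENT.
* §1 `onLat N g` (extension by zero from `N•ℤ^{d+1}`), `cwsum N w Q := wsum (onLat N w) (onLat N Q)` with `cwsum_apply` (it IS the coarse
  sum `Σ'_y w y · Q y`), `biLoc_cwsum` (weights decaying in fine units from `p`, kernels bi-localised at their coarse point ⇒ bi-localised
  at `p`, rate `δ/2`), `cwsum_translate`; `SLam N c Q2` with `locStencil_SLam`, `SLam_translate`.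
* §2 `exp_coarse_le_fine` (coarse-unit decay = fine-unit decay at rate `δ/N`), `transportV N R 𝒱` with `vertexFamily_transportV`
  (a vertex family at the composite blocking `N·L`, rate `min (δR/N) δ / 2`) and `transportV_translate`.
* §3 `abs_wsumTerm_le_right`, `biLoc_wsum_right` / `biLoc_wsum_left` (ONE leg summed, the other centre fixed), `biLoc_transpose`,
  `biLoc_cwsum_right` / `biLoc_cwsum_left`; `transportW N R 𝒲` with `vertexFamily₂_transportW` (rate `min (δR/N) δ / 4`).
* §4 `slot`, `lift M s t K` (the `(slot s, slot t)` block of `K`, in `M`-coarse coordinates, placed on the sublattice `M•ℤ^{d+1}` in the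
  `(inr, inr)` slots), `lift_zsmul` / `lift_inl_left` / `lift_inl_right` / `lift_off` (pins), `decays_lift` (fine-unit decay at rate `δ/M`).
* §5 (v1.1) `legOff`, `legPt_eq_add_legOff`, `avgLift M G` (the fine entry at `(x,a; w,b)` collects, over the leg indices whose leg
  points can be `x`, `w`, the coarse entries, weighted `legW a · legW b`; leg-point multiplicities respected exactly as in `dec`),
  `avgLift_inr_inr` (pin), `avgLift_shiftK`, `biLoc_avgLift` (rate `δ/M`, constant `C·e^{4(d+1)δ}`); §5.2 `sublattice_injective`,
  `eq_zsmul_quo_add_off`, `tsum_sublattice` / `summable_sublattice` (re-indexing a fine sum supported on `off + M•ℤ^{d+1}` as a coarse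
  sum — unconditional for `tsum`), `tadpole_avgLift` (decaying `K`, bi-localised `G`: `tr (K · Q′ᵀGQ′) = tr (Q′KQ′ᵀ · G)`); §5.3
  `tsum_mul_sublattice` / `summable_mul_sublattice`, `summable_bdd_mul_decay`, `summable_bdd_mul_biLoc`, `abs_tsum_bdd_mul_biLoc_le`,
  the half-decimations `rdec M K = K Q′ᵀ`, `ldec M K = Q′ K` and the right lift `rlift M H = H Q′` with `sum_legW_mul_rdec` /
  `sum_legW_mul_ldec` (`Q′(KQ′ᵀ) = (Q′K)Q′ᵀ = dec`), `abs_rdec_le` / `abs_ldec_le`, `abs_comp_rdec_le`, and the three associativity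
  steps `comp_avgLift_eq_rlift` (`K(Q′ᵀVQ′) = ((KQ′ᵀ)V)Q′`), `comp_rlift_eq` (`(HQ′)K′ = H(Q′K′)`), `dec_comp_rdec_ldec`, assembled as
  `dec_comp_avgLift_comp`.  USE ((D-μ), the delegated telescoping P6): a step-`j` jet is a kernel on the step-`j` legs; against the
  COMPOSITE fine-lattice fluctuation covariance it enters as `avgLift (Lc^j) (·)`, and the two identities turn the resulting fine-level
  tadpoles / bubbles into step-level ones against the DECIMATED covariance `dec (Lc^j) (·)` (= `KInvStep`, `OneStepKernelFamily` §2).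
* §6 (v1.1) `slotW d M s` (`M^(d+2)` for a field-type slot, `1` for a multiplier slot; `slotW_true_mul_legW`: it is the reciprocal of the
  mean leg weight), `liftW M s t K := slotW s · slotW t · lift M s t K` with the pins `liftW_zsmul` / `liftW_false_false` / `liftW_inl_left` /
  `liftW_inl_right` / `liftW_off` and `decays_liftW` — the unit bookkeeping (one factor `M^(d+2)` per FIELD slot) that an identity composing
  a level-`M` packed resolvent (multiplier legs dual to the UNNORMALISED contour sum) with a decimated kernel (`dec`: MEAN weights) needs
  (an4 lineage, finding X-an4-37; `BETA/AN2.md` §25).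

All declarations are [folklore]: definitions, or proved here from the imports; zero cited facts; the B12 tag above is a LOCATOR only.
-/

open Finset
open scoped BigOperators
open Literature.MathematicalPhysics.QuantumFieldTheory
open Literature.MathematicalPhysics.QuantumFieldTheory.Balaban1983to89
open Literature.MathematicalPhysics.QuantumFieldTheory.Balaban1983to89.Beta
open Literature.Probability.LatticeModels (Torus.proj)
open LatticeForm (quo proj_add_zsmul)
open BlochFibreUniqueness (quo_add_zsmul)
open B12Sec2to5 (l1 l1_nonneg)
open ExpKernelCalculus (Decays BiLoc VertexFamily VertexFamily₂ shiftK Zl Zl_nonneg l1_natSmul l1_sub_triangle summable_exp_shift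
  tsum_exp_shift)
open OneStepResolventKernel (Fib LocStencil wsum biLoc_wsum biLoc_finset_sum wsum_shift proj_zsmul quo_zsmul eq_zsmul_quo_of_proj
  bound_mono biLoc_mono)

noncomputable section

namespace Literature.MathematicalPhysics.QuantumFieldTheory.Balaban1983to89.Beta.InterLevelTransport

/-! ## §1 Extension by zero and COARSE-INDEXED SUPERPOSITIONS of coarse-localised kernels; the abstract multiplier-curvature
## stencil `SLam` -/

section Coarse

variable {d : ℕ} {N : ℕ}

/-- EXTENSION BY ZERO from the coarse sublattice: a coarse-indexed family `g y` read at the fine points `N•y`, `0` off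
`N•ℤ^{d+1}`. [folklore] -/
def onLat {α : Type*} [Zero α] (N : ℕ) (g : (Fin (d + 1) → ℤ) → α) : (Fin (d + 1) → ℤ) → α :=
  fun v => if Torus.proj N v = 0 then g (quo N v) else 0

/-- On the sublattice `onLat` reads the family. [folklore] -/
theorem onLat_zsmul [NeZero N] {α : Type*} [Zero α] (g : (Fin (d + 1) → ℤ) → α) (y : Fin (d + 1) → ℤ) :
    onLat N g ((N : ℤ) • y) = g y := by
  simp only [onLat, proj_zsmul, quo_zsmul, if_true]

/-- Off the sublattice `onLat` vanishes. [folklore] -/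
theorem onLat_off {α : Type*} [Zero α] (g : (Fin (d + 1) → ℤ) → α) {v : Fin (d + 1) → ℤ} (hv : Torus.proj N v ≠ 0) :
    onLat N g v = 0 := by
  simp only [onLat, hv, if_false]

/-- **COARSE-INDEXED SUPERPOSITION** `cwsum N w Q := Σ_y w y • Q y` of a family of kernels indexed by the COARSE points,
realised as a fine `wsum` of the extensions by zero (so that the `wsum` calculus of `OneStepResolventKernel` §4 applies).
Uses: the multiplier-curvature stencil `SLam` below (weights = conversion coefficients of the multiplier response, kernels =
the one-step averaging second jets `Q_b″`), and the response transport of vertex families in the composite jets. [folklore] -/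
def cwsum (N : ℕ) (w : (Fin (d + 1) → ℤ) → ℝ) (Q : (Fin (d + 1) → ℤ) → ExpKernelCalculus.MKer (d + 1) (Fib d)) :
    ExpKernelCalculus.MKer (d + 1) (Fib d) :=
  wsum (onLat N w) (onLat N Q)

/-- The superposition IS the coarse sum `Σ'_y w y · Q y x z a b` (re-indexing the fine sum along the injection `y ↦ N•y`).
[folklore] -/
theorem cwsum_apply [NeZero N] (w : (Fin (d + 1) → ℤ) → ℝ) (Q : (Fin (d + 1) → ℤ) → ExpKernelCalculus.MKer (d + 1) (Fib d))
    (x z : Fin (d + 1) → ℤ) (a b : Fib d) :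
    cwsum N w Q x z a b = ∑' y : (Fin (d + 1) → ℤ), w y * Q y x z a b := by
  unfold cwsum wsum
  have hinj : Function.Injective (fun y : (Fin (d + 1) → ℤ) => (N : ℤ) • y) := by
    intro y y' h
    have := congrArg (quo N) h
    simpa only [quo_zsmul] using this
  rw [← hinj.tsum_eq (f := fun v => onLat N w v * onLat N Q v x z a b)]
  · exact tsum_congr (fun y => by simp only [onLat_zsmul])
  · intro v hv
    by_cases h0 : Torus.proj N v = 0
    · exact ⟨quo N v, (eq_zsmul_quo_of_proj (N := N) h0).symm⟩
    · refine (Function.mem_support.mp hv ?_).elim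
      show onLat N w v * onLat N Q v x z a b = 0
      rw [onLat_off w h0, zero_mul]

/-- **BI-LOCALISATION OF A COARSE-INDEXED SUPERPOSITION**: weights decaying (rate `δ`, in FINE units) from a fine point `p`
as a function of the coarse point `N•y`, kernels bi-localised at their own coarse point ⇒ the superposition is bi-localised at
`p` (rate `δ/2`, constant `C·C_Q·Zl(δ/2)`). [folklore] -/
theorem biLoc_cwsum [NeZero N] {w : (Fin (d + 1) → ℤ) → ℝ} {Q : (Fin (d + 1) → ℤ) → ExpKernelCalculus.MKer (d + 1) (Fib d)}
    {C Cq δ : ℝ} {p : Fin (d + 1) → ℤ} (hw : ∀ y, |w y| ≤ C * Real.exp (-δ * l1 ((N : ℤ) • y - p)))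
    (hQ : ∀ y, BiLoc (Q y) ((N : ℤ) • y) ((N : ℤ) • y) Cq δ) (hδ : 0 < δ) (hC : 0 ≤ C) :
    BiLoc (cwsum N w Q) p p (C * Cq * Zl (d + 1) (δ / 2)) (δ / 2) := by
  have hCq : 0 ≤ Cq := (hQ 0).nonneg (Sum.inl 0)
  refine biLoc_wsum (fun v => ?_) (fun v => ?_) hδ hC
  · by_cases hv : Torus.proj N v = 0
    · have e := eq_zsmul_quo_of_proj (N := N) hv
      simp only [onLat, hv, if_true]
      have h := hw (quo N v)
      rwa [← e] at h
    · rw [onLat_off w hv, abs_zero]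
      positivity
  · by_cases hv : Torus.proj N v = 0
    · have e := eq_zsmul_quo_of_proj (N := N) hv
      simp only [onLat, hv, if_true]
      have h := hQ (quo N v)
      rwa [← e] at h
    · intro x z a b
      rw [onLat_off Q hv]
      show |(0 : ℝ)| ≤ _
      rw [abs_zero]
      positivity

/-- COVARIANCE of the superposition under coarse translations: shifting the weights by `t` and using a translation-covariant
kernel family shifts the kernel by `N•t`. [folklore] -/
theorem cwsum_translate [NeZero N] (w : (Fin (d + 1) → ℤ) → ℝ)
    {Q : (Fin (d + 1) → ℤ) → ExpKernelCalculus.MKer (d + 1) (Fib d)} (t : Fin (d + 1) → ℤ)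
    (hQ : ∀ y, Q (y + t) = shiftK (-((N : ℤ) • t)) (Q y)) :
    cwsum N (fun y => w (y - t)) Q = shiftK (-((N : ℤ) • t)) (cwsum N w Q) := by
  unfold cwsum
  have hw' : onLat N (fun y => w (y - t)) = fun v => onLat N w (v - (N : ℤ) • t) := by
    funext v
    simp only [onLat]
    have hp : Torus.proj N (v - (N : ℤ) • t) = Torus.proj N v := by
      rw [sub_eq_add_neg, ← smul_neg, proj_add_zsmul]
    have hq : quo N (v - (N : ℤ) • t) = quo N v - t := by
      rw [sub_eq_add_neg, ← smul_neg, quo_add_zsmul, ← sub_eq_add_neg]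
    rw [hp, hq]
  rw [hw']
  refine wsum_shift (onLat N w) ((N : ℤ) • t) (fun v => ?_)
  simp only [onLat]
  have hp : Torus.proj N (v + (N : ℤ) • t) = Torus.proj N v := proj_add_zsmul _ _
  have hq : quo N (v + (N : ℤ) • t) = quo N v + t := quo_add_zsmul _ _
  rw [hp, hq]
  by_cases hv : Torus.proj N v = 0
  · simp only [hv, if_true, hQ]
  · simp only [hv, if_false]
    rfl

/-- **THE ABSTRACT MULTIPLIER-CURVATURE STENCIL** `S^Λ κ′ u := −Σ_μ Σ_y c μ y κ′ u • Q2 μ y`: the first `B`-jet of the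
Lagrange term `−Λ·Q″` of the bordered Lagrangian Hessian at the symmetric point (where `Λ = 0`), i.e. `−Λ′[e_{(u,κ′)}]·Q″` with the
multiplier response `Λ′` to a fine perturbation converted into the coefficients `c μ y κ′ u` (for Bałaban's data:
`c = ((Q′Q′ᵀ)⁻¹ Q′ A″)_{(μ,y),(κ′,u)}` from the first block row of the KKT system, and `Q2 μ y` = the field–field kernel of the
second jet of the one-step averaging at the coarse bond `(μ, y)` — both DELIVERED by the convention owners, abstract here).
[folklore] -/
def SLam (N : ℕ) (c : Fin (d + 1) → (Fin (d + 1) → ℤ) → Fin (d + 1) → (Fin (d + 1) → ℤ) → ℝ)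
    (Q2 : Fin (d + 1) → (Fin (d + 1) → ℤ) → ExpKernelCalculus.MKer (d + 1) (Fib d)) :
    Fin (d + 1) → (Fin (d + 1) → ℤ) → ExpKernelCalculus.MKer (d + 1) (Fib d) :=
  fun κ' u x z a b => -(∑ μ : Fin (d + 1), cwsum N (fun y => c μ y κ' u) (Q2 μ) x z a b)

/-- **LOCALISATION OF `S^Λ`**: conversion coefficients decaying (fine units, rate `δ`) from the perturbed fine bond and averaging
second jets localised at their coarse bond (`VertexFamily Q2 N Cq δ`) make `S^Λ` a local stencil family (`LocStencil`, rate `δ/2`).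
[folklore] -/
theorem locStencil_SLam [NeZero N] {c : Fin (d + 1) → (Fin (d + 1) → ℤ) → Fin (d + 1) → (Fin (d + 1) → ℤ) → ℝ}
    {Q2 : Fin (d + 1) → (Fin (d + 1) → ℤ) → ExpKernelCalculus.MKer (d + 1) (Fib d)} {C Cq δ : ℝ}
    (hc : ∀ μ y κ' u, |c μ y κ' u| ≤ C * Real.exp (-δ * l1 ((N : ℤ) • y - u))) (hQ : VertexFamily Q2 N Cq δ) (hδ : 0 < δ)
    (hC : 0 ≤ C) : LocStencil (SLam N c Q2) ((d + 1 : ℕ) * (C * Cq * Zl (d + 1) (δ / 2))) (δ / 2) := by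
  intro κ' u x z a b
  have hsum : BiLoc (fun x z a b => ∑ μ : Fin (d + 1), cwsum N (fun y => c μ y κ' u) (Q2 μ) x z a b) u u
      (∑ _μ : Fin (d + 1), C * Cq * Zl (d + 1) (δ / 2)) (δ / 2) :=
    biLoc_finset_sum Finset.univ (fun μ _ => biLoc_cwsum (fun y => hc μ y κ' u) (fun y => hQ μ y) hδ hC)
  have h := hsum x z a b
  simp only [Finset.sum_const, Finset.card_univ, Fintype.card_fin, nsmul_eq_mul] at h
  show |-(∑ μ : Fin (d + 1), cwsum N (fun y => c μ y κ' u) (Q2 μ) x z a b)| ≤ _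
  rw [abs_neg]
  exact h

/-- **TRANSLATION COVARIANCE OF `S^Λ`** under coarse translations: covariant conversion coefficients and a covariant averaging
family give `S^Λ κ′ (u + N•t) = shiftK (−N•t) (S^Λ κ′ u)`. [folklore] -/
theorem SLam_translate [NeZero N] {c : Fin (d + 1) → (Fin (d + 1) → ℤ) → Fin (d + 1) → (Fin (d + 1) → ℤ) → ℝ}
    {Q2 : Fin (d + 1) → (Fin (d + 1) → ℤ) → ExpKernelCalculus.MKer (d + 1) (Fib d)}
    (hc : ∀ μ y κ' u (t : Fin (d + 1) → ℤ), c μ (y + t) κ' (u + (N : ℤ) • t) = c μ y κ' u)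
    (hQ : ∀ μ y (t : Fin (d + 1) → ℤ), Q2 μ (y + t) = shiftK (-((N : ℤ) • t)) (Q2 μ y)) (κ' : Fin (d + 1))
    (u t : Fin (d + 1) → ℤ) : SLam N c Q2 κ' (u + (N : ℤ) • t) = shiftK (-((N : ℤ) • t)) (SLam N c Q2 κ' u) := by
  funext x z a b
  simp only [SLam, shiftK]
  congr 1
  refine Finset.sum_congr rfl (fun μ _ => ?_)
  have hw : (fun y => c μ y κ' (u + (N : ℤ) • t)) = fun y => c μ (y - t) κ' u := by
    funext y
    have := hc μ (y - t) κ' u t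
    rwa [sub_add_cancel] at this
  rw [hw, cwsum_translate (fun y => c μ y κ' u) t (fun y => hQ μ y t)]
  rfl

end Coarse

/-! ## §2 RESPONSE TRANSPORT of first-order vertex families one blocking level up -/

section Transport

variable {d : ℕ} {N : ℕ}

/-- Fine-unit decay from a coarse-lattice decay: `|y′ − L•z|₁`-decay at rate `δ` on the `N`-coarse lattice is
`|N•y′ − (N L)•z|₁`-decay at rate `δ / N` in fine units. [folklore] -/
theorem exp_coarse_le_fine (hN : 0 < N) (δ : ℝ) (L : ℕ) (y' z : Fin (d + 1) → ℤ) :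
    Real.exp (-δ * l1 (y' - (L : ℤ) • z)) ≤ Real.exp (-(δ / N) * l1 ((N : ℤ) • y' - ((N * L : ℕ) : ℤ) • z)) := by
  have hNr : (0 : ℝ) < N := by exact_mod_cast hN
  have e : (N : ℤ) • y' - ((N * L : ℕ) : ℤ) • z = (N : ℤ) • (y' - (L : ℤ) • z) := by
    rw [smul_sub, smul_smul]; push_cast; rfl
  rw [e, l1_natSmul]
  refine Real.exp_le_exp.2 (le_of_eq ?_)
  field_simp

/-- **RESPONSE TRANSPORT OF A FIRST-ORDER VERTEX FAMILY**: `transportV N R 𝒱 μ z := Σ_{μ′} Σ'_{y′} R μ z μ′ y′ • 𝒱 μ′ y′` —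
the vertex family `𝒱` (indexed by the bonds `(μ′, y′)` of the `N`-coarse lattice, kernels on the fine lattice) driven through a
RESPONSE KERNEL `R μ z μ′ y′` of the next blocking step (`L`): the response of the bond variable `(μ′, y′)` to the coarser bond
variable `(μ, z)` (for Bałaban's data `R = colH (KInvStep Lc j) Lc`, the step minimiser).  This is the chain rule
`∂_{B(μ,z)} = Σ R(μ′,y′ ← μ,z) ∂_{V(μ′,y′)}` on first jets; the composite one-shot first jet is built from it ((D-μ)). [folklore] -/
def transportV (N : ℕ) (R : Fin (d + 1) → (Fin (d + 1) → ℤ) → Fin (d + 1) → (Fin (d + 1) → ℤ) → ℝ)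
    (𝒱 : Fin (d + 1) → (Fin (d + 1) → ℤ) → ExpKernelCalculus.MKer (d + 1) (Fib d)) (μ : Fin (d + 1)) (z : Fin (d + 1) → ℤ) :
    ExpKernelCalculus.MKer (d + 1) (Fib d) :=
  fun x w a b => ∑ μ' : Fin (d + 1), cwsum N (fun y' => R μ z μ' y') (𝒱 μ') x w a b

/-- **THE TRANSPORTED FAMILY IS A VERTEX FAMILY AT THE COMPOSITE BLOCKING `N·L`**: a response kernel decaying on the `N`-coarse
lattice from the coarser bond's point `L•z` (rate `δR`, constant `CR`) and a vertex family at blocking `N` (rate `δ`) give a vertex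
family at blocking `N·L` with rate `min (δR/N) δ / 2`. [folklore] -/
theorem vertexFamily_transportV [NeZero N]
    {R : Fin (d + 1) → (Fin (d + 1) → ℤ) → Fin (d + 1) → (Fin (d + 1) → ℤ) → ℝ}
    {𝒱 : Fin (d + 1) → (Fin (d + 1) → ℤ) → ExpKernelCalculus.MKer (d + 1) (Fib d)} {CR δR Cv δ : ℝ} {L : ℕ}
    (hR : ∀ μ z μ' y', |R μ z μ' y'| ≤ CR * Real.exp (-δR * l1 (y' - (L : ℤ) • z))) (hCR : 0 ≤ CR) (hδR : 0 < δR)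
    (hV : VertexFamily 𝒱 N Cv δ) (hδ : 0 < δ) :
    VertexFamily (transportV N R 𝒱) (N * L) ((d + 1 : ℕ) * (CR * Cv * Zl (d + 1) (min (δR / N) δ / 2))) (min (δR / N) δ / 2) := by
  intro μ z
  have hN : 0 < N := Nat.pos_of_ne_zero (NeZero.ne N)
  have hNr : (0 : ℝ) < N := by exact_mod_cast hN
  have hCv : 0 ≤ Cv := (hV 0 0).nonneg (Sum.inl 0)
  set δ₀ : ℝ := min (δR / N) δ with hδ₀
  have hδ₀pos : 0 < δ₀ := lt_min (div_pos hδR hNr) hδ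
  have hw : ∀ μ' y', |R μ z μ' y'| ≤ CR * Real.exp (-δ₀ * l1 ((N : ℤ) • y' - ((N * L : ℕ) : ℤ) • z)) := by
    intro μ' y'
    have h1 := (hR μ z μ' y').trans (mul_le_mul_of_nonneg_left (exp_coarse_le_fine hN δR L y' z) hCR)
    exact bound_mono h1 hCR le_rfl (min_le_left _ _) (l1_nonneg _)
  have hV' : ∀ μ' y', BiLoc (𝒱 μ' y') ((N : ℤ) • y') ((N : ℤ) • y') Cv δ₀ :=
    fun μ' y' => biLoc_mono (hV μ' y') hCv (min_le_right _ _)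
  have hsum : BiLoc (fun x w a b => ∑ μ' : Fin (d + 1), cwsum N (fun y' => R μ z μ' y') (𝒱 μ') x w a b)
      (((N * L : ℕ) : ℤ) • z) (((N * L : ℕ) : ℤ) • z) (∑ _μ' : Fin (d + 1), CR * Cv * Zl (d + 1) (δ₀ / 2)) (δ₀ / 2) :=
    biLoc_finset_sum Finset.univ (fun μ' _ => biLoc_cwsum (fun y' => hw μ' y') (fun y' => hV' μ' y') hδ₀pos hCR)
  simp only [Finset.sum_const, Finset.card_univ, Fintype.card_fin, nsmul_eq_mul] at hsum
  exact hsum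

/-- **TRANSLATION COVARIANCE OF THE TRANSPORT**: a response kernel covariant under simultaneous translation of the two levels
(`z ↦ z + t`, `y′ ↦ y′ + L•t`) and a vertex family covariant under its own coarse translations give a transported family covariant
under the composite translations `z ↦ z + t` ↦ `shiftK (−(N L)•t)`. [folklore] -/
theorem transportV_translate [NeZero N]
    {R : Fin (d + 1) → (Fin (d + 1) → ℤ) → Fin (d + 1) → (Fin (d + 1) → ℤ) → ℝ}
    {𝒱 : Fin (d + 1) → (Fin (d + 1) → ℤ) → ExpKernelCalculus.MKer (d + 1) (Fib d)} {L : ℕ}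
    (hR : ∀ μ z μ' y' (t : Fin (d + 1) → ℤ), R μ (z + t) μ' (y' + (L : ℤ) • t) = R μ z μ' y')
    (hV : ∀ μ' y' (s : Fin (d + 1) → ℤ), 𝒱 μ' (y' + s) = shiftK (-((N : ℤ) • s)) (𝒱 μ' y')) (μ : Fin (d + 1))
    (z t : Fin (d + 1) → ℤ) :
    transportV N R 𝒱 μ (z + t) = shiftK (-(((N * L : ℕ) : ℤ) • t)) (transportV N R 𝒱 μ z) := by
  funext x w a b
  simp only [transportV, shiftK]
  refine Finset.sum_congr rfl (fun μ' _ => ?_)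
  have hw : (fun y' => R μ (z + t) μ' y') = fun y' => R μ z μ' (y' - (L : ℤ) • t) := by
    funext y'
    have := hR μ z μ' (y' - (L : ℤ) • t) t
    rwa [sub_add_cancel] at this
  rw [hw, cwsum_translate (fun y' => R μ z μ' y') ((L : ℤ) • t) (fun y' => hV μ' y' _)]
  simp only [shiftK, smul_smul]
  congr 2

end Transport

/-! ## §3 One-sided superposition bounds and the TWO-LEG TRANSPORT of second-order vertex families -/

section Transport₂

variable {d : ℕ} {N : ℕ}

/-- Termwise bound, RIGHT leg summed: weight decaying from `q`, kernel bi-localised at `(p₀, u)` ⇒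
`≤ C·Cₖ·e^{−δ|x−p₀|₁}·e^{−(δ/2)|w−q|₁}·e^{−(δ/2)|w−u|₁}`. [folklore] -/
theorem abs_wsumTerm_le_right {w : (Fin (d + 1) → ℤ) → ℝ} {K : (Fin (d + 1) → ℤ) → ExpKernelCalculus.MKer (d + 1) (Fib d)}
    {C Ck δ : ℝ} {p₀ q : Fin (d + 1) → ℤ} (hw : ∀ u, |w u| ≤ C * Real.exp (-δ * l1 (u - q)))
    (hK : ∀ u, BiLoc (K u) p₀ u Ck δ) (hδ : 0 ≤ δ) (hC : 0 ≤ C) (x z : Fin (d + 1) → ℤ) (a b : Fib d)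
    (u : Fin (d + 1) → ℤ) :
    |w u * K u x z a b| ≤
      C * Ck * Real.exp (-δ * l1 (x - p₀) + -(δ / 2) * l1 (z - q)) * Real.exp (-(δ / 2) * l1 (z - u)) := by
  rw [abs_mul]
  have h1 := hw u
  have h2 := hK u x z a b
  have hCk : 0 ≤ Ck := (hK u).nonneg a
  calc |w u| * |K u x z a b|
      ≤ (C * Real.exp (-δ * l1 (u - q))) * (Ck * Real.exp (-δ * (l1 (x - p₀) + l1 (z - u)))) :=
        mul_le_mul h1 h2 (abs_nonneg _) ((abs_nonneg _).trans h1)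
    _ = C * Ck * Real.exp (-δ * l1 (u - q) + -δ * (l1 (x - p₀) + l1 (z - u))) := by rw [Real.exp_add]; ring
    _ ≤ C * Ck * Real.exp ((-δ * l1 (x - p₀) + -(δ / 2) * l1 (z - q)) + -(δ / 2) * l1 (z - u)) := by
        refine mul_le_mul_of_nonneg_left (Real.exp_le_exp.2 ?_) (mul_nonneg hC hCk)
        have tz : l1 (z - q) ≤ l1 (z - u) + l1 (u - q) := l1_sub_triangle z u q
        nlinarith [mul_nonneg hδ (show 0 ≤ l1 (z - u) + l1 (u - q) - l1 (z - q) by linarith),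
          mul_nonneg hδ (l1_nonneg (z - u)), mul_nonneg hδ (l1_nonneg (u - q))]
    _ = _ := by rw [Real.exp_add]; ring

/-- **RIGHT-LEG SUPERPOSITION BOUND**: weights decaying from `q`, kernels `K u` bi-localised at `(p₀, u)` (fixed left centre)
⇒ `wsum w K` is bi-localised at `(p₀, q)` (rate `δ/2`, constant `C·Cₖ·Zl(δ/2)`). [folklore] -/
theorem biLoc_wsum_right {w : (Fin (d + 1) → ℤ) → ℝ} {K : (Fin (d + 1) → ℤ) → ExpKernelCalculus.MKer (d + 1) (Fib d)}
    {C Ck δ : ℝ} {p₀ q : Fin (d + 1) → ℤ} (hw : ∀ u, |w u| ≤ C * Real.exp (-δ * l1 (u - q)))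
    (hK : ∀ u, BiLoc (K u) p₀ u Ck δ) (hδ : 0 < δ) (hC : 0 ≤ C) :
    BiLoc (wsum w K) p₀ q (C * Ck * Zl (d + 1) (δ / 2)) (δ / 2) := by
  intro x z a b
  unfold wsum
  have hCk : 0 ≤ Ck := (hK 0).nonneg a
  have hs := summable_exp_shift (half_pos hδ) z
  have hmaj := hs.mul_left (C * Ck * Real.exp (-δ * l1 (x - p₀) + -(δ / 2) * l1 (z - q)))
  have hb := tsum_of_norm_bounded hmaj.hasSum
    (fun u => by rw [Real.norm_eq_abs]; exact abs_wsumTerm_le_right hw hK hδ.le hC x z a b u)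
  rw [Real.norm_eq_abs] at hb
  refine hb.trans ?_
  rw [tsum_mul_left, tsum_exp_shift]
  have hZ : 0 ≤ Zl (d + 1) (δ / 2) := Zl_nonneg (half_pos hδ)
  calc C * Ck * Real.exp (-δ * l1 (x - p₀) + -(δ / 2) * l1 (z - q)) * Zl (d + 1) (δ / 2)
      ≤ C * Ck * Real.exp (-(δ / 2) * (l1 (x - p₀) + l1 (z - q))) * Zl (d + 1) (δ / 2) := by
        refine mul_le_mul_of_nonneg_right (mul_le_mul_of_nonneg_left (Real.exp_le_exp.2 ?_) (mul_nonneg hC hCk)) hZ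
        nlinarith [mul_nonneg hδ.le (l1_nonneg (x - p₀))]
    _ = C * Ck * Zl (d + 1) (δ / 2) * Real.exp (-(δ / 2) * (l1 (x - p₀) + l1 (z - q))) := by ring

/-- The TRANSPOSE of a kernel family swaps the legs of `BiLoc` and commutes with `wsum`. [folklore] -/
theorem biLoc_transpose {K : ExpKernelCalculus.MKer (d + 1) (Fib d)} {p q : Fin (d + 1) → ℤ} {C δ : ℝ}
    (h : BiLoc K p q C δ) : BiLoc (fun x z a b => K z x b a) q p C δ := by
  intro x z a b
  have := h z x b a
  rwa [add_comm] at this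

/-- **LEFT-LEG SUPERPOSITION BOUND** (transpose of the right-leg one): weights decaying from `p`, kernels `K u` bi-localised at
`(u, q₀)` ⇒ `wsum w K` bi-localised at `(p, q₀)`. [folklore] -/
theorem biLoc_wsum_left {w : (Fin (d + 1) → ℤ) → ℝ} {K : (Fin (d + 1) → ℤ) → ExpKernelCalculus.MKer (d + 1) (Fib d)}
    {C Ck δ : ℝ} {p q₀ : Fin (d + 1) → ℤ} (hw : ∀ u, |w u| ≤ C * Real.exp (-δ * l1 (u - p)))
    (hK : ∀ u, BiLoc (K u) u q₀ Ck δ) (hδ : 0 < δ) (hC : 0 ≤ C) :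
    BiLoc (wsum w K) p q₀ (C * Ck * Zl (d + 1) (δ / 2)) (δ / 2) := by
  have h := biLoc_wsum_right (K := fun u => fun x z a b => K u z x b a) hw (fun u => biLoc_transpose (hK u)) hδ hC
  have h' := biLoc_transpose h
  refine fun x z a b => (le_of_eq ?_).trans (h' x z a b)
  simp only [wsum]

/-- `cwsum` form of the right-leg bound (weights decaying in fine units from `q` as a function of `N•y`, kernels bi-localised at
`(p₀, N•y)`). [folklore] -/
theorem biLoc_cwsum_right [NeZero N] {w : (Fin (d + 1) → ℤ) → ℝ}
    {Q : (Fin (d + 1) → ℤ) → ExpKernelCalculus.MKer (d + 1) (Fib d)} {C Cq δ : ℝ} {p₀ q : Fin (d + 1) → ℤ}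
    (hw : ∀ y, |w y| ≤ C * Real.exp (-δ * l1 ((N : ℤ) • y - q))) (hQ : ∀ y, BiLoc (Q y) p₀ ((N : ℤ) • y) Cq δ)
    (hCq : 0 ≤ Cq) (hδ : 0 < δ) (hC : 0 ≤ C) : BiLoc (cwsum N w Q) p₀ q (C * Cq * Zl (d + 1) (δ / 2)) (δ / 2) := by
  refine biLoc_wsum_right (fun v => ?_) (fun v => ?_) hδ hC
  · by_cases hv : Torus.proj N v = 0
    · have e := eq_zsmul_quo_of_proj (N := N) hv
      simp only [onLat, hv, if_true]
      have h := hw (quo N v)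
      rwa [← e] at h
    · rw [onLat_off w hv, abs_zero]
      positivity
  · by_cases hv : Torus.proj N v = 0
    · have e := eq_zsmul_quo_of_proj (N := N) hv
      simp only [onLat, hv, if_true]
      have h := hQ (quo N v)
      rwa [← e] at h
    · intro x z a b
      rw [onLat_off Q hv]
      show |(0 : ℝ)| ≤ _
      rw [abs_zero]
      positivity

/-- `cwsum` form of the left-leg bound. [folklore] -/
theorem biLoc_cwsum_left [NeZero N] {w : (Fin (d + 1) → ℤ) → ℝ}
    {Q : (Fin (d + 1) → ℤ) → ExpKernelCalculus.MKer (d + 1) (Fib d)} {C Cq δ : ℝ} {p q₀ : Fin (d + 1) → ℤ}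
    (hw : ∀ y, |w y| ≤ C * Real.exp (-δ * l1 ((N : ℤ) • y - p))) (hQ : ∀ y, BiLoc (Q y) ((N : ℤ) • y) q₀ Cq δ)
    (hCq : 0 ≤ Cq) (hδ : 0 < δ) (hC : 0 ≤ C) : BiLoc (cwsum N w Q) p q₀ (C * Cq * Zl (d + 1) (δ / 2)) (δ / 2) := by
  refine biLoc_wsum_left (fun v => ?_) (fun v => ?_) hδ hC
  · by_cases hv : Torus.proj N v = 0
    · have e := eq_zsmul_quo_of_proj (N := N) hv
      simp only [onLat, hv, if_true]
      have h := hw (quo N v)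
      rwa [← e] at h
    · rw [onLat_off w hv, abs_zero]
      positivity
  · by_cases hv : Torus.proj N v = 0
    · have e := eq_zsmul_quo_of_proj (N := N) hv
      simp only [onLat, hv, if_true]
      have h := hQ (quo N v)
      rwa [← e] at h
    · intro x z a b
      rw [onLat_off Q hv]
      show |(0 : ℝ)| ≤ _
      rw [abs_zero]
      positivity

/-- **TWO-LEG RESPONSE TRANSPORT OF A SECOND-ORDER VERTEX FAMILY**:
`transportW N R 𝒲 μ z ν z′ := Σ_{μ′,ν′} Σ'_{y′} R μ z μ′ y′ • Σ'_{y″} R ν z′ ν′ y″ • 𝒲 μ′ y′ ν′ y″` — both bond slots of `𝒲` driven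
through the response kernel of the next step (the `Rᵀ 𝒲 R` part of the chain rule for second jets; the second-RESPONSE part
`R⁽²⁾ · 𝒱` is a `transportV` with a two-bond response and is added separately). [folklore] -/
def transportW (N : ℕ) (R : Fin (d + 1) → (Fin (d + 1) → ℤ) → Fin (d + 1) → (Fin (d + 1) → ℤ) → ℝ)
    (𝒲 : Fin (d + 1) → (Fin (d + 1) → ℤ) → Fin (d + 1) → (Fin (d + 1) → ℤ) → ExpKernelCalculus.MKer (d + 1) (Fib d))
    (μ : Fin (d + 1)) (z : Fin (d + 1) → ℤ) (ν : Fin (d + 1)) (z' : Fin (d + 1) → ℤ) : ExpKernelCalculus.MKer (d + 1) (Fib d) :=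
  fun x w a b => ∑ μ' : Fin (d + 1), ∑ ν' : Fin (d + 1),
    cwsum N (fun y' => R μ z μ' y') (fun y' => cwsum N (fun y'' => R ν z' ν' y'') (fun y'' => 𝒲 μ' y' ν' y'')) x w a b

/-- **THE TWO-LEG TRANSPORT IS A SECOND-ORDER VERTEX FAMILY AT THE COMPOSITE BLOCKING `N·L`** (rate `min (δR/N) δ / 4`).
[folklore] -/
theorem vertexFamily₂_transportW [NeZero N]
    {R : Fin (d + 1) → (Fin (d + 1) → ℤ) → Fin (d + 1) → (Fin (d + 1) → ℤ) → ℝ}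
    {𝒲 : Fin (d + 1) → (Fin (d + 1) → ℤ) → Fin (d + 1) → (Fin (d + 1) → ℤ) → ExpKernelCalculus.MKer (d + 1) (Fib d)}
    {CR δR Cw δ : ℝ} {L : ℕ}
    (hR : ∀ μ z μ' y', |R μ z μ' y'| ≤ CR * Real.exp (-δR * l1 (y' - (L : ℤ) • z))) (hCR : 0 ≤ CR) (hδR : 0 < δR)
    (hW : VertexFamily₂ 𝒲 N Cw δ) (hδ : 0 < δ) :
    VertexFamily₂ (transportW N R 𝒲) (N * L)
      ((d + 1 : ℕ) * ((d + 1 : ℕ) * (CR * (CR * Cw * Zl (d + 1) (min (δR / N) δ / 2)) * Zl (d + 1) (min (δR / N) δ / 2 / 2))))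
      (min (δR / N) δ / 2 / 2) := by
  intro μ z ν z'
  have hN : 0 < N := Nat.pos_of_ne_zero (NeZero.ne N)
  have hNr : (0 : ℝ) < N := by exact_mod_cast hN
  have hCw : 0 ≤ Cw := (hW 0 0 0 0).nonneg (Sum.inl 0)
  set δ₀ : ℝ := min (δR / N) δ with hδ₀
  have hδ₀pos : 0 < δ₀ := lt_min (div_pos hδR hNr) hδ
  have hw : ∀ μ₁ z₁ μ' y', |R μ₁ z₁ μ' y'| ≤ CR * Real.exp (-δ₀ * l1 ((N : ℤ) • y' - ((N * L : ℕ) : ℤ) • z₁)) := by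
    intro μ₁ z₁ μ' y'
    have h1 := (hR μ₁ z₁ μ' y').trans (mul_le_mul_of_nonneg_left (exp_coarse_le_fine hN δR L y' z₁) hCR)
    exact bound_mono h1 hCR le_rfl (min_le_left _ _) (l1_nonneg _)
  -- inner sums (right leg), at fixed left bond `(μ′, y′)`
  have hin : ∀ μ' y' ν', BiLoc (cwsum N (fun y'' => R ν z' ν' y'') (fun y'' => 𝒲 μ' y' ν' y''))
      ((N : ℤ) • y') (((N * L : ℕ) : ℤ) • z') (CR * Cw * Zl (d + 1) (δ₀ / 2)) (δ₀ / 2) := by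
    intro μ' y' ν'
    exact biLoc_cwsum_right (fun y'' => hw ν z' ν' y'') (fun y'' => biLoc_mono (hW μ' y' ν' y'') hCw (min_le_right _ _))
      hCw hδ₀pos hCR
  have hZ : 0 ≤ CR * Cw * Zl (d + 1) (δ₀ / 2) := mul_nonneg (mul_nonneg hCR hCw) (Zl_nonneg (half_pos hδ₀pos))
  -- outer sums (left leg)
  have hout : ∀ μ' ν', BiLoc (cwsum N (fun y' => R μ z μ' y')
      (fun y' => cwsum N (fun y'' => R ν z' ν' y'') (fun y'' => 𝒲 μ' y' ν' y'')))
      (((N * L : ℕ) : ℤ) • z) (((N * L : ℕ) : ℤ) • z') (CR * (CR * Cw * Zl (d + 1) (δ₀ / 2)) * Zl (d + 1) (δ₀ / 2 / 2))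
      (δ₀ / 2 / 2) := by
    intro μ' ν'
    refine biLoc_cwsum_left (fun y' => ?_) (fun y' => hin μ' y' ν') hZ (half_pos hδ₀pos) hCR
    exact bound_mono (hw μ z μ' y') hCR le_rfl (by linarith) (l1_nonneg _)
  have hsum : BiLoc (fun x w a b => ∑ μ' : Fin (d + 1), ∑ ν' : Fin (d + 1), cwsum N (fun y' => R μ z μ' y')
      (fun y' => cwsum N (fun y'' => R ν z' ν' y'') (fun y'' => 𝒲 μ' y' ν' y'')) x w a b)
      (((N * L : ℕ) : ℤ) • z) (((N * L : ℕ) : ℤ) • z')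
      (∑ _μ' : Fin (d + 1), ∑ _ν' : Fin (d + 1), CR * (CR * Cw * Zl (d + 1) (δ₀ / 2)) * Zl (d + 1) (δ₀ / 2 / 2))
      (δ₀ / 2 / 2) :=
    biLoc_finset_sum Finset.univ (fun μ' _ =>
      biLoc_finset_sum Finset.univ (fun ν' _ => hout μ' ν'))
  simp only [Finset.sum_const, Finset.card_univ, Fintype.card_fin, nsmul_eq_mul] at hsum
  exact hsum

end Transport₂


/-! ## §4 The inter-level LIFT of a block of a coarse-coordinate kernel onto the fine multiplier legs -/

section Lift

variable {d : ℕ}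

/-- Read the fibre summand selected by a Boolean: `true ↦ inl` (field leg), `false ↦ inr` (multiplier leg). [folklore] -/
def slot (s : Bool) (κ : Fin (d + 1)) : Fib d := if s then Sum.inl κ else Sum.inr κ

/-- **INTER-LEVEL LIFT.** `lift M s t K`: the `(slot s, slot t)`-block of a kernel `K` written in the coordinates of the `M`-times
COARSER lattice, transported to the FINE coordinates as a kernel supported on the sublattice `M•ℤ^{d+1}` in the `(inr, inr)` slots
(zero elsewhere).  Intended use (the interface of the delegated node P6): with `K = KInvStep Lc j` and `M = Lc^j`, `s = t = true`
lifts the step fluctuation covariance onto the multiplier legs of `KInv (N := Lc^j)`; `s = true, t = false` lifts the step minimiser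
(its own multiplier legs, at `Lc•z` in step coordinates, land at `Lc^(j+1)•z`).  One lift per block: a single lift carrying several
blocks would collide at the fine points common to `Lc^j•ℤ^{d+1}` and `Lc^(j+1)•ℤ^{d+1}`. [folklore] -/
def lift (M : ℕ) (s t : Bool) (K : ExpKernelCalculus.MKer (d + 1) (Fib d)) : ExpKernelCalculus.MKer (d + 1) (Fib d) :=
  fun x y a b =>
    match a, b with
    | Sum.inr κ, Sum.inr l =>
        if Torus.proj M x = 0 ∧ Torus.proj M y = 0 then K (quo M x) (quo M y) (slot s κ) (slot t l) else 0
    | _, _ => 0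

/-- PIN: on the sublattice, in the `(inr, inr)` slots, the lift reads the requested block. [folklore] -/
theorem lift_zsmul (M : ℕ) [NeZero M] (s t : Bool) (K : ExpKernelCalculus.MKer (d + 1) (Fib d)) (x' y' : Fin (d + 1) → ℤ)
    (κ l : Fin (d + 1)) :
    lift M s t K ((M : ℤ) • x') ((M : ℤ) • y') (Sum.inr κ) (Sum.inr l) = K x' y' (slot s κ) (slot t l) := by
  simp only [lift, proj_zsmul, quo_zsmul, and_self, if_true]

/-- PIN: the lift vanishes when the left slot is a field slot. [folklore] -/
theorem lift_inl_left (M : ℕ) (s t : Bool) (K : ExpKernelCalculus.MKer (d + 1) (Fib d)) (x y : Fin (d + 1) → ℤ)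
    (κ : Fin (d + 1)) (b : Fib d) : lift M s t K x y (Sum.inl κ) b = 0 := by
  cases b <;> rfl

/-- PIN: the lift vanishes when the right slot is a field slot. [folklore] -/
theorem lift_inl_right (M : ℕ) (s t : Bool) (K : ExpKernelCalculus.MKer (d + 1) (Fib d)) (x y : Fin (d + 1) → ℤ)
    (a : Fib d) (l : Fin (d + 1)) : lift M s t K x y a (Sum.inl l) = 0 := by
  cases a <;> rfl

/-- PIN: the lift vanishes off the sublattice (either leg). [folklore] -/
theorem lift_off (M : ℕ) (s t : Bool) (K : ExpKernelCalculus.MKer (d + 1) (Fib d)) {x y : Fin (d + 1) → ℤ}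
    (h : Torus.proj M x ≠ 0 ∨ Torus.proj M y ≠ 0) (a b : Fib d) : lift M s t K x y a b = 0 := by
  rcases a with κ | κ
  · rfl
  rcases b with l | l
  · rfl
  have hne : ¬(Torus.proj M x = 0 ∧ Torus.proj M y = 0) := by
    rintro ⟨hx, hy⟩
    rcases h with h | h <;> contradiction
  simp only [lift, hne, if_false]

/-- **FINE-UNIT DECAY OF THE LIFT**: a kernel decaying at rate `δ` in `M`-coarse units lifts to a kernel decaying at rate `δ/M` in
fine units (same constant). [folklore] -/
theorem decays_lift (M : ℕ) [NeZero M] (s t : Bool) {K : ExpKernelCalculus.MKer (d + 1) (Fib d)} {C δ : ℝ}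
    (hK : Decays K C δ) : Decays (lift M s t K) C (δ / M) := by
  have hC : 0 ≤ C := hK.nonneg (Sum.inl 0)
  have hM : 0 < M := Nat.pos_of_ne_zero (NeZero.ne M)
  have hMr : (0 : ℝ) < M := by exact_mod_cast hM
  intro x y a b
  by_cases h : Torus.proj M x = 0 ∧ Torus.proj M y = 0
  · rcases a with κ | κ
    · rw [lift_inl_left, abs_zero]; positivity
    rcases b with l | l
    · rw [lift_inl_right, abs_zero]; positivity
    obtain ⟨hx, hy⟩ := h
    have ex := eq_zsmul_quo_of_proj (N := M) hx
    have ey := eq_zsmul_quo_of_proj (N := M) hy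
    simp only [lift, hx, hy, and_self, if_true]
    refine (hK (quo M x) (quo M y) (slot s κ) (slot t l)).trans (le_of_eq ?_)
    congr 1
    conv_rhs => rw [ex, ey, ← smul_sub, l1_natSmul]
    congr 1
    field_simp
  · rw [lift_off M s t K (not_and_or.mp h) a b, abs_zero]
    positivity

end Lift

/-! ## §5 The AVERAGING LIFT of a coarse-leg kernel onto the fine legs (`Q′ᵀ G Q′`, the transpose partner of `dec`) -/

section AvgLift

variable {d : ℕ}

open Literature.MathematicalPhysics.QuantumFieldTheory.Balaban1983to89.Beta.ExpKernelCalculus (l1_sub_symm tr comp tadpole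
  summable_exp_shift' tsum_exp_shift')
open Literature.MathematicalPhysics.QuantumFieldTheory.Balaban1983to89.Beta.OneStepKernelFamily (legSet legPt legW dec legW_nonneg
  sum_legW legPt_add l1_legPt_sub_le)

/-- The OFFSET of a leg index: its leg point over the coarse point `0` (`r + s e_κ` for a field leg, `0` for a multiplier leg).
[folklore] -/
def legOff (M : ℕ) (a : Fib d) (i : (Fin (d + 1) → ℕ) × ℕ) : Fin (d + 1) → ℤ := legPt M a 0 i

/-- Leg points are the offsets translated by the coarse point: `legPt M a x′ i = M•x′ + legOff M a i`. [folklore] -/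
theorem legPt_eq_add_legOff (M : ℕ) (a : Fib d) (x' : Fin (d + 1) → ℤ) (i : (Fin (d + 1) → ℕ) × ℕ) :
    legPt M a x' i = (M : ℤ) • x' + legOff M a i := by
  have h := legPt_add M a 0 x' i
  rw [zero_add] at h
  exact h.trans (add_comm _ _)

/-- **THE AVERAGING LIFT** `avgLift M G := Q′ᵀ G Q′`: a kernel `G` on the legs of the `M`-times COARSER lattice (field legs =
coarse bond variables, multiplier legs at coarse points) pulled back to the FINE legs through the linearised block-contour
averaging `Q′` (the same leg sets / points / weights as `OneStepKernelFamily.dec`, which is `K ↦ Q′ K Q′ᵀ`): the fine entry at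
`(x, a; w, b)` collects, over the leg indices `i`, `i′` whose leg points can be `x`, `w` (i.e. `x − legOff a i ∈ M•ℤ^{d+1}`), the
coarse entry at the corresponding coarse points, weighted `legW a · legW b`.  Use ((D-μ)): the step Lagrange-term jets, kernels on
the step-`j` legs, enter the composite fine-lattice jet data as `avgLift (Lc^j) (·)`. [folklore] -/
def avgLift (M : ℕ) (G : ExpKernelCalculus.MKer (d + 1) (Fib d)) : ExpKernelCalculus.MKer (d + 1) (Fib d) :=
  fun x w a b => ∑ i ∈ legSet d M a, ∑ i' ∈ legSet d M b,
    legW d M a * legW d M b *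
      (if Torus.proj M (x - legOff M a i) = 0 ∧ Torus.proj M (w - legOff M b i') = 0 then
        G (quo M (x - legOff M a i)) (quo M (w - legOff M b i')) a b else 0)

/-- PIN: on multiplier legs the averaging lift reads `G` at the coarse points. [folklore] -/
theorem avgLift_inr_inr (M : ℕ) [NeZero M] (G : ExpKernelCalculus.MKer (d + 1) (Fib d)) (z z' : Fin (d + 1) → ℤ)
    (μ ν : Fin (d + 1)) :
    avgLift M G ((M : ℤ) • z) ((M : ℤ) • z') (Sum.inr μ) (Sum.inr ν) = G z z' (Sum.inr μ) (Sum.inr ν) := by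
  simp only [avgLift, legSet, legOff, legPt, legW, smul_zero, sub_zero, Finset.sum_singleton, one_mul, proj_zsmul, quo_zsmul,
    and_self, if_true]

/-- The averaging lift intertwines coarse shifts with fine shifts by `M` times as much. [folklore] -/
theorem avgLift_shiftK (M : ℕ) [NeZero M] (v : Fin (d + 1) → ℤ) (G : ExpKernelCalculus.MKer (d + 1) (Fib d)) :
    avgLift M (shiftK v G) = shiftK ((M : ℤ) • v) (avgLift M G) := by
  funext x w a b
  simp only [avgLift, shiftK]
  refine Finset.sum_congr rfl (fun i _ => Finset.sum_congr rfl (fun i' _ => ?_))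
  have hx : x + (M : ℤ) • v - legOff M a i = (x - legOff M a i) + (M : ℤ) • v := by abel
  have hw : w + (M : ℤ) • v - legOff M b i' = (w - legOff M b i') + (M : ℤ) • v := by abel
  rw [hx, hw, proj_add_zsmul, proj_add_zsmul, quo_add_zsmul, quo_add_zsmul]

/-- **THE AVERAGING LIFT OF A BI-LOCALISED KERNEL IS BI-LOCALISED** at the `M`-fold coarse centres, rate `δ/M` in fine units,
constant `C·e^{4(d+1)δ}` (the leg offsets have `ℓ¹`-size `≤ 2(d+1)M`). [folklore] -/
theorem biLoc_avgLift (M : ℕ) [NeZero M] {G : ExpKernelCalculus.MKer (d + 1) (Fib d)} {p q : Fin (d + 1) → ℤ} {C δ : ℝ}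
    (hG : BiLoc G p q C δ) (hδ : 0 ≤ δ) :
    BiLoc (avgLift M G) ((M : ℤ) • p) ((M : ℤ) • q) (C * Real.exp (4 * (d + 1) * δ)) (δ / M) := by
  have hC : 0 ≤ C := hG.nonneg (Sum.inl 0)
  have hM0 : M ≠ 0 := NeZero.ne M
  have hMr : (0 : ℝ) < M := by exact_mod_cast Nat.pos_of_ne_zero hM0
  intro x w a b
  -- termwise bound
  have hterm : ∀ i ∈ legSet d M a, ∀ i' ∈ legSet d M b,
      |legW d M a * legW d M b *
        (if Torus.proj M (x - legOff M a i) = 0 ∧ Torus.proj M (w - legOff M b i') = 0 then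
          G (quo M (x - legOff M a i)) (quo M (w - legOff M b i')) a b else 0)| ≤
      legW d M a * legW d M b *
        (C * Real.exp (4 * (d + 1) * δ) * Real.exp (-(δ / M) * (l1 (x - (M : ℤ) • p) + l1 (w - (M : ℤ) • q)))) := by
    intro i hi i' hi'
    rw [abs_mul, abs_of_nonneg (mul_nonneg (legW_nonneg M a) (legW_nonneg M b))]
    refine mul_le_mul_of_nonneg_left ?_ (mul_nonneg (legW_nonneg M a) (legW_nonneg M b))
    split_ifs with h
    · obtain ⟨hx, hw⟩ := h
      have ex := eq_zsmul_quo_of_proj (N := M) hx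
      have ew := eq_zsmul_quo_of_proj (N := M) hw
      refine (hG _ _ a b).trans ?_
      rw [mul_assoc]
      refine mul_le_mul_of_nonneg_left ?_ hC
      rw [← Real.exp_add]
      refine Real.exp_le_exp.2 ?_
      -- `M · l1 (quo (x − off) − p) = l1 (x − off − M p) ≥ l1 (x − M p) − l1 (off)`
      have h1 : (M : ℝ) * l1 (quo M (x - legOff M a i) - p) = l1 ((x - legOff M a i) - (M : ℤ) • p) := by
        rw [← l1_natSmul, smul_sub, ← ex]
      have h2 : (M : ℝ) * l1 (quo M (w - legOff M b i') - q) = l1 ((w - legOff M b i') - (M : ℤ) • q) := by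
        rw [← l1_natSmul, smul_sub, ← ew]
      have t1 : l1 (x - (M : ℤ) • p) ≤ l1 ((x - legOff M a i) - (M : ℤ) • p) + 2 * (d + 1) * M := by
        have tri := l1_sub_triangle x (x - legOff M a i) ((M : ℤ) • p)
        have hoff : l1 (x - (x - legOff M a i)) ≤ 2 * (d + 1) * M := by
          have := l1_legPt_sub_le M a 0 hi
          simp only [smul_zero, sub_zero] at this
          rw [show x - (x - legOff M a i) = legOff M a i by abel]
          exact this
        linarith
      have t2 : l1 (w - (M : ℤ) • q) ≤ l1 ((w - legOff M b i') - (M : ℤ) • q) + 2 * (d + 1) * M := by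
        have tri := l1_sub_triangle w (w - legOff M b i') ((M : ℤ) • q)
        have hoff : l1 (w - (w - legOff M b i')) ≤ 2 * (d + 1) * M := by
          have := l1_legPt_sub_le M b 0 hi'
          simp only [smul_zero, sub_zero] at this
          rw [show w - (w - legOff M b i') = legOff M b i' by abel]
          exact this
        linarith
      -- divide by `M`
      have key : (δ / M) * (l1 (x - (M : ℤ) • p) + l1 (w - (M : ℤ) • q)) ≤
          δ * (l1 (quo M (x - legOff M a i) - p) + l1 (quo M (w - legOff M b i') - q)) + 4 * (d + 1) * δ := by
        rw [div_mul_eq_mul_div, div_le_iff₀ hMr]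
        have e3 : (δ * (l1 (quo M (x - legOff M a i) - p) + l1 (quo M (w - legOff M b i') - q)) + 4 * (d + 1) * δ) * M =
            δ * ((M : ℝ) * l1 (quo M (x - legOff M a i) - p) + (M : ℝ) * l1 (quo M (w - legOff M b i') - q)) +
              δ * (4 * (d + 1) * M) := by ring
        rw [e3, h1, h2]
        nlinarith [mul_le_mul_of_nonneg_left t1 hδ, mul_le_mul_of_nonneg_left t2 hδ]
      linarith
    · rw [abs_zero]; positivity
  calc |avgLift M G x w a b|
      ≤ ∑ i ∈ legSet d M a, ∑ i' ∈ legSet d M b, |legW d M a * legW d M b *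
          (if Torus.proj M (x - legOff M a i) = 0 ∧ Torus.proj M (w - legOff M b i') = 0 then
            G (quo M (x - legOff M a i)) (quo M (w - legOff M b i')) a b else 0)| := by
        unfold avgLift
        exact (Finset.abs_sum_le_sum_abs _ _).trans (Finset.sum_le_sum fun i _ => Finset.abs_sum_le_sum_abs _ _)
    _ ≤ ∑ i ∈ legSet d M a, ∑ i' ∈ legSet d M b, legW d M a * legW d M b *
          (C * Real.exp (4 * (d + 1) * δ) * Real.exp (-(δ / M) * (l1 (x - (M : ℤ) • p) + l1 (w - (M : ℤ) • q)))) :=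
        Finset.sum_le_sum fun i hi => Finset.sum_le_sum fun i' hi' => hterm i hi i' hi'
    _ = C * Real.exp (4 * (d + 1) * δ) * Real.exp (-(δ / M) * (l1 (x - (M : ℤ) • p) + l1 (w - (M : ℤ) • q))) := by
        rw [← Finset.sum_mul, ← Finset.sum_mul, Finset.sum_comm, ← Finset.sum_mul]
        simp only [Finset.sum_const, nsmul_eq_mul]
        have ha := sum_legW (d := d) hM0 a
        have hb := sum_legW (d := d) hM0 b
        simp only [Finset.sum_const, nsmul_eq_mul] at ha hb
        have h1 : ((legSet d M b).card : ℝ) * (((legSet d M a).card : ℝ) * legW d M a * legW d M b) = 1 := by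
          calc ((legSet d M b).card : ℝ) * (((legSet d M a).card : ℝ) * legW d M a * legW d M b)
              = (((legSet d M a).card : ℝ) * legW d M a) * (((legSet d M b).card : ℝ) * legW d M b) := by ring
            _ = 1 := by rw [ha, hb, one_mul]
        rw [h1, one_mul]

/-! ### §5.2 Sublattice re-indexing and the ADJOINTNESS `tadpole K (avgLift M G) = tadpole (dec M K) G` -/

/-- The residue-class embedding `z ↦ M•z + off` is injective. [folklore] -/
theorem sublattice_injective (M : ℕ) [NeZero M] (off : Fin (d + 1) → ℤ) :
    Function.Injective (fun z : Fin (d + 1) → ℤ => (M : ℤ) • z + off) := by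
  intro z z' h
  have h' : (M : ℤ) • z = (M : ℤ) • z' := add_right_cancel h
  have := congrArg (quo M) h'
  simpa only [quo_zsmul] using this

/-- A fine point congruent to `off` mod `M` is `M•(quo M (x − off)) + off`. [folklore] -/
theorem eq_zsmul_quo_add_off {M : ℕ} [NeZero M] {off x : Fin (d + 1) → ℤ} (h : Torus.proj M (x - off) = 0) :
    (M : ℤ) • quo M (x - off) + off = x := by
  rw [← eq_zsmul_quo_of_proj (N := M) h, sub_add_cancel]

/-- SUBLATTICE RE-INDEXING of a lattice sum: summing `g (quo M (x − off))` over the fine points `x ≡ off (mod M)` (and `0`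
elsewhere) is summing `g` over the coarse lattice — unconditionally (`tsum` on both sides). [folklore] -/
theorem tsum_sublattice (M : ℕ) [NeZero M] (off : Fin (d + 1) → ℤ) (g : (Fin (d + 1) → ℤ) → ℝ) :
    ∑' x : Fin (d + 1) → ℤ, (if Torus.proj M (x - off) = 0 then g (quo M (x - off)) else 0) = ∑' z, g z := by
  rw [← (sublattice_injective M off).tsum_eq
    (f := fun x => if Torus.proj M (x - off) = 0 then g (quo M (x - off)) else 0) ?_]
  · exact tsum_congr fun z => by simp only [add_sub_cancel_right, proj_zsmul, quo_zsmul, if_true]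
  · intro x hx
    by_cases h0 : Torus.proj M (x - off) = 0
    · exact ⟨quo M (x - off), eq_zsmul_quo_add_off h0⟩
    · exact absurd (by simp only [h0, if_false]) (Function.mem_support.mp hx)

/-- Summability transfers along the sublattice re-indexing. [folklore] -/
theorem summable_sublattice (M : ℕ) [NeZero M] (off : Fin (d + 1) → ℤ) {g : (Fin (d + 1) → ℤ) → ℝ} (hg : Summable g) :
    Summable (fun x : Fin (d + 1) → ℤ => if Torus.proj M (x - off) = 0 then g (quo M (x - off)) else 0) := by
  refine ((sublattice_injective M off).summable_iff
    (f := fun x => if Torus.proj M (x - off) = 0 then g (quo M (x - off)) else 0) ?_).mp ?_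
  · intro x hx
    by_cases h0 : Torus.proj M (x - off) = 0
    · exact absurd ⟨quo M (x - off), eq_zsmul_quo_add_off h0⟩ hx
    · simp only [h0, if_false]
  · exact hg.congr fun z => by simp only [Function.comp_apply, add_sub_cancel_right, proj_zsmul, quo_zsmul, if_true]

/-- **ADJOINTNESS OF THE AVERAGING LIFT AND THE DECIMATION**: `tr (K · Q′ᵀGQ′) = tr (Q′KQ′ᵀ · G)`, i.e.
`tadpole K (avgLift M G) = tadpole (dec M K) G` for a decaying fine kernel `K` and a bi-localised coarse kernel `G` (absolute
convergence from the bi-localisation of `G`; only boundedness of `K` is used).  Use ((D-μ)): a step-`j` Lagrange / constraint jet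
`G` (a kernel on the step-`j` legs) paired with the COMPOSITE fine-lattice fluctuation covariance `K` equals the same jet paired with
the DECIMATED covariance `dec (Lc^j) K` — the step-level trace that appears in the telescoping. [folklore] -/
theorem tadpole_avgLift (M : ℕ) [NeZero M] {K G : ExpKernelCalculus.MKer (d + 1) (Fib d)} {CK δK CG δG : ℝ}
    {p q : Fin (d + 1) → ℤ} (hK : Decays K CK δK) (hδK : 0 ≤ δK) (hG : BiLoc G p q CG δG) (hδG : 0 < δG) :
    tadpole K (avgLift M G) = tadpole (dec M K) G := by
  have hCK : 0 ≤ CK := hK.nonneg (Sum.inl 0)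
  have hCG : 0 ≤ CG := hG.nonneg (Sum.inl 0)
  have bK : ∀ x y a b, |K x y a b| ≤ CK := fun x y a b =>
    (hK x y a b).trans (mul_le_of_le_one_right hCK (Real.exp_le_one_iff.mpr (by nlinarith [l1_nonneg (x - y)])))
  have bG : ∀ z z' a b, |G z z' a b| ≤ CG * Real.exp (-δG * l1 (z - p)) := fun z z' a b =>
    (hG z z' a b).trans (mul_le_mul_of_nonneg_left (Real.exp_le_exp.2 (by nlinarith [l1_nonneg (z' - q), l1_nonneg (z - p)])) hCG)
  -- (T1) summability in the coarse composition variable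
  have T1 : ∀ (φ : (Fin (d + 1) → ℤ) → (Fin (d + 1) → ℤ)) (x₀ w₀ : Fin (d + 1) → ℤ) (a f : Fib d) (c : ℝ),
      Summable (fun z => K x₀ (φ z) a f * (c * G z w₀ f a)) := by
    intro φ x₀ w₀ a f c
    refine Summable.of_norm_bounded ((summable_exp_shift' hδG p).mul_left (CK * (|c| * CG))) (fun z => ?_)
    rw [Real.norm_eq_abs, abs_mul, abs_mul]
    calc |K x₀ (φ z) a f| * (|c| * |G z w₀ f a|) ≤ CK * (|c| * (CG * Real.exp (-δG * l1 (z - p)))) :=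
          mul_le_mul (bK _ _ _ _) (mul_le_mul_of_nonneg_left (bG _ _ _ _) (abs_nonneg c)) (by positivity) hCK
      _ = CK * (|c| * CG) * Real.exp (-δG * l1 (z - p)) := by ring
  -- (T2) summability of the inner sums in the coarse trace variable
  have T2 : ∀ (φ ψ : (Fin (d + 1) → ℤ) → (Fin (d + 1) → ℤ)) (a f : Fib d) (c : ℝ),
      Summable (fun z' => ∑' z, K (ψ z') (φ z) a f * (c * G z z' f a)) := by
    intro φ ψ a f c
    refine Summable.of_norm_bounded ((summable_exp_shift' hδG q).mul_left (CK * (|c| * CG) * Zl (d + 1) δG)) (fun z' => ?_)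
    have hs : Summable (fun z => CK * (|c| * CG) * Real.exp (-δG * l1 (z' - q)) * Real.exp (-δG * l1 (z - p))) :=
      (summable_exp_shift' hδG p).mul_left _
    have hb : ∀ z, ‖K (ψ z') (φ z) a f * (c * G z z' f a)‖ ≤
        CK * (|c| * CG) * Real.exp (-δG * l1 (z' - q)) * Real.exp (-δG * l1 (z - p)) := by
      intro z
      rw [Real.norm_eq_abs, abs_mul, abs_mul]
      have e : Real.exp (-δG * (l1 (z - p) + l1 (z' - q))) = Real.exp (-δG * l1 (z' - q)) * Real.exp (-δG * l1 (z - p)) := by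
        rw [← Real.exp_add]; congr 1; ring
      calc |K (ψ z') (φ z) a f| * (|c| * |G z z' f a|) ≤ CK * (|c| * (CG * Real.exp (-δG * (l1 (z - p) + l1 (z' - q))))) :=
            mul_le_mul (bK _ _ _ _) (mul_le_mul_of_nonneg_left (hG z z' f a) (abs_nonneg c)) (by positivity) hCK
        _ = CK * (|c| * CG) * Real.exp (-δG * l1 (z' - q)) * Real.exp (-δG * l1 (z - p)) := by rw [e]; ring
    calc ‖∑' z, K (ψ z') (φ z) a f * (c * G z z' f a)‖
        ≤ ∑' z, CK * (|c| * CG) * Real.exp (-δG * l1 (z' - q)) * Real.exp (-δG * l1 (z - p)) :=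
          tsum_of_norm_bounded hs.hasSum hb
      _ = CK * (|c| * CG) * Zl (d + 1) δG * Real.exp (-δG * l1 (z' - q)) := by rw [tsum_mul_left, tsum_exp_shift']; ring
  -- the LHS inner summand as a sublattice-supported function of the fine composition variable `y`
  have pt : ∀ (x : Fin (d + 1) → ℤ) (a f : Fib d) (i i' : (Fin (d + 1) → ℕ) × ℕ) (y : Fin (d + 1) → ℤ),
      K x y a f * (legW d M f * legW d M a *
        (if Torus.proj M (y - legOff M f i) = 0 ∧ Torus.proj M (x - legOff M a i') = 0 then
          G (quo M (y - legOff M f i)) (quo M (x - legOff M a i')) f a else 0)) =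
      (if Torus.proj M (y - legOff M f i) = 0 then
        (fun z => if Torus.proj M (x - legOff M a i') = 0 then
            K x (legPt M f z i) a f * ((legW d M a * legW d M f) * G z (quo M (x - legOff M a i')) f a) else 0)
          (quo M (y - legOff M f i)) else 0) := by
    intro x a f i i' y
    by_cases hy : Torus.proj M (y - legOff M f i) = 0
    · have ey : legPt M f (quo M (y - legOff M f i)) i = y := by rw [legPt_eq_add_legOff, eq_zsmul_quo_add_off hy]
      by_cases hx : Torus.proj M (x - legOff M a i') = 0
      · simp only [hy, hx, and_self, if_true, ey]; ring
      · simp only [hy, hx, and_false, if_false, if_true, mul_zero]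
    · simp only [hy, false_and, if_false, mul_zero]
  -- the LHS outer summand as a sublattice-supported function of the fine trace variable `x`
  have pt2 : ∀ (a f : Fib d) (i i' : (Fin (d + 1) → ℕ) × ℕ) (x : Fin (d + 1) → ℤ),
      (if Torus.proj M (x - legOff M a i') = 0 then
        ∑' z, K x (legPt M f z i) a f * ((legW d M a * legW d M f) * G z (quo M (x - legOff M a i')) f a) else 0) =
      (if Torus.proj M (x - legOff M a i') = 0 then
        (fun z' => ∑' z, K (legPt M a z' i') (legPt M f z i) a f * ((legW d M a * legW d M f) * G z z' f a))
          (quo M (x - legOff M a i')) else 0) := by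
    intro a f i i' x
    by_cases hx : Torus.proj M (x - legOff M a i') = 0
    · have ex : legPt M a (quo M (x - legOff M a i')) i' = x := by rw [legPt_eq_add_legOff, eq_zsmul_quo_add_off hx]
      simp only [hx, if_true, ex]
    · simp only [hx, if_false]
  -- summability of the LHS summands
  have sm : ∀ (x : Fin (d + 1) → ℤ) (a f : Fib d) (i i' : (Fin (d + 1) → ℕ) × ℕ),
      Summable (fun y => K x y a f * (legW d M f * legW d M a *
        (if Torus.proj M (y - legOff M f i) = 0 ∧ Torus.proj M (x - legOff M a i') = 0 then
          G (quo M (y - legOff M f i)) (quo M (x - legOff M a i')) f a else 0))) := by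
    intro x a f i i'
    have H : Summable (fun z => if Torus.proj M (x - legOff M a i') = 0 then
        K x (legPt M f z i) a f * ((legW d M a * legW d M f) * G z (quo M (x - legOff M a i')) f a) else 0) := by
      by_cases hx : Torus.proj M (x - legOff M a i') = 0
      · simp only [hx, if_true]; exact T1 (fun z => legPt M f z i) x (quo M (x - legOff M a i')) a f _
      · simp only [hx, if_false]; exact summable_zero
    exact (summable_sublattice M (legOff M f i) H).congr (fun y => (pt x a f i i' y).symm)
  have sm2 : ∀ (a f : Fib d) (i i' : (Fin (d + 1) → ℕ) × ℕ),
      Summable (fun x => if Torus.proj M (x - legOff M a i') = 0 then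
        ∑' z, K x (legPt M f z i) a f * ((legW d M a * legW d M f) * G z (quo M (x - legOff M a i')) f a) else 0) := by
    intro a f i i'
    exact (summable_sublattice M (legOff M a i')
      (T2 (fun z => legPt M f z i) (fun z' => legPt M a z' i') a f (legW d M a * legW d M f))).congr
      (fun x => (pt2 a f i i' x).symm)
  -- LHS to canonical form
  have lhs : tadpole K (avgLift M G) = ∑ a : Fib d, ∑ f : Fib d, ∑ i ∈ legSet d M f, ∑ i' ∈ legSet d M a,
      ∑' z', ∑' z, K (legPt M a z' i') (legPt M f z i) a f * ((legW d M a * legW d M f) * G z z' f a) := by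
    have inner : ∀ x a, (∑' y, ∑ f, K x y a f * avgLift M G y x f a) =
        ∑ f, ∑ i ∈ legSet d M f, ∑ i' ∈ legSet d M a,
          (if Torus.proj M (x - legOff M a i') = 0 then
            ∑' z, K x (legPt M f z i) a f * ((legW d M a * legW d M f) * G z (quo M (x - legOff M a i')) f a) else 0) := by
      intro x a
      have ex : (fun y => ∑ f, K x y a f * avgLift M G y x f a) = fun y => ∑ f, ∑ i ∈ legSet d M f, ∑ i' ∈ legSet d M a,
          K x y a f * (legW d M f * legW d M a *
            (if Torus.proj M (y - legOff M f i) = 0 ∧ Torus.proj M (x - legOff M a i') = 0 then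
              G (quo M (y - legOff M f i)) (quo M (x - legOff M a i')) f a else 0)) := by
        funext y
        refine Finset.sum_congr rfl (fun f _ => ?_)
        simp only [avgLift, Finset.mul_sum]
      rw [ex, Summable.tsum_finsetSum (fun f _ => summable_sum (fun i _ => summable_sum (fun i' _ => sm x a f i i')))]
      refine Finset.sum_congr rfl (fun f _ => ?_)
      rw [Summable.tsum_finsetSum (fun i _ => summable_sum (fun i' _ => sm x a f i i'))]
      refine Finset.sum_congr rfl (fun i _ => ?_)
      rw [Summable.tsum_finsetSum (fun i' _ => sm x a f i i')]
      refine Finset.sum_congr rfl (fun i' _ => ?_)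
      refine ((tsum_congr (pt x a f i i')).trans (tsum_sublattice M (legOff M f i) (fun z =>
        if Torus.proj M (x - legOff M a i') = 0 then
          K x (legPt M f z i) a f * ((legW d M a * legW d M f) * G z (quo M (x - legOff M a i')) f a) else 0))).trans ?_
      by_cases hx : Torus.proj M (x - legOff M a i') = 0
      · simp only [hx, if_true]
      · simp only [hx, if_false, tsum_zero]
    simp only [tadpole, tr, comp]
    rw [tsum_congr (fun x => Finset.sum_congr rfl (fun a _ => inner x a))]
    rw [Summable.tsum_finsetSum (fun a _ => summable_sum (fun f _ => summable_sum (fun i _ =>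
      summable_sum (fun i' _ => sm2 a f i i'))))]
    refine Finset.sum_congr rfl (fun a _ => ?_)
    rw [Summable.tsum_finsetSum (fun f _ => summable_sum (fun i _ => summable_sum (fun i' _ => sm2 a f i i')))]
    refine Finset.sum_congr rfl (fun f _ => ?_)
    rw [Summable.tsum_finsetSum (fun i _ => summable_sum (fun i' _ => sm2 a f i i'))]
    refine Finset.sum_congr rfl (fun i _ => ?_)
    rw [Summable.tsum_finsetSum (fun i' _ => sm2 a f i i')]
    refine Finset.sum_congr rfl (fun i' _ => ?_)
    exact (tsum_congr (pt2 a f i i')).trans (tsum_sublattice M (legOff M a i') (fun z' =>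
      ∑' z, K (legPt M a z' i') (legPt M f z i) a f * ((legW d M a * legW d M f) * G z z' f a)))
  -- RHS to canonical form
  have rhs : tadpole (dec M K) G = ∑ a : Fib d, ∑ f : Fib d, ∑ i' ∈ legSet d M a, ∑ i ∈ legSet d M f,
      ∑' z', ∑' z, K (legPt M a z' i') (legPt M f z i) a f * ((legW d M a * legW d M f) * G z z' f a) := by
    have inner : ∀ z' a, (∑' z, ∑ f, dec M K z' z a f * G z z' f a) =
        ∑ f, ∑ i' ∈ legSet d M a, ∑ i ∈ legSet d M f,
          ∑' z, K (legPt M a z' i') (legPt M f z i) a f * ((legW d M a * legW d M f) * G z z' f a) := by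
      intro z' a
      have ex : (fun z => ∑ f, dec M K z' z a f * G z z' f a) = fun z => ∑ f, ∑ i' ∈ legSet d M a, ∑ i ∈ legSet d M f,
          K (legPt M a z' i') (legPt M f z i) a f * ((legW d M a * legW d M f) * G z z' f a) := by
        funext z
        refine Finset.sum_congr rfl (fun f _ => ?_)
        simp only [dec, Finset.sum_mul]
        refine Finset.sum_congr rfl (fun i' _ => Finset.sum_congr rfl (fun i _ => by ring))
      rw [ex, Summable.tsum_finsetSum (fun f _ => summable_sum (fun i' _ => summable_sum (fun i _ =>
        T1 (fun z => legPt M f z i) _ _ a f _)))]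
      refine Finset.sum_congr rfl (fun f _ => ?_)
      rw [Summable.tsum_finsetSum (fun i' _ => summable_sum (fun i _ => T1 (fun z => legPt M f z i) _ _ a f _))]
      refine Finset.sum_congr rfl (fun i' _ => ?_)
      rw [Summable.tsum_finsetSum (fun i _ => T1 (fun z => legPt M f z i) _ _ a f _)]
    simp only [tadpole, tr, comp]
    rw [tsum_congr (fun z' => Finset.sum_congr rfl (fun a _ => inner z' a))]
    rw [Summable.tsum_finsetSum (fun a _ => summable_sum (fun f _ => summable_sum (fun i' _ =>
      summable_sum (fun i _ => T2 (fun z => legPt M f z i) (fun z' => legPt M a z' i') a f _))))]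
    refine Finset.sum_congr rfl (fun a _ => ?_)
    rw [Summable.tsum_finsetSum (fun f _ => summable_sum (fun i' _ =>
      summable_sum (fun i _ => T2 (fun z => legPt M f z i) (fun z' => legPt M a z' i') a f _)))]
    refine Finset.sum_congr rfl (fun f _ => ?_)
    rw [Summable.tsum_finsetSum (fun i' _ =>
      summable_sum (fun i _ => T2 (fun z => legPt M f z i) (fun z' => legPt M a z' i') a f _))]
    refine Finset.sum_congr rfl (fun i' _ => ?_)
    rw [Summable.tsum_finsetSum (fun i _ => T2 (fun z => legPt M f z i) (fun z' => legPt M a z' i') a f _)]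
  rw [lhs, rhs]
  exact Finset.sum_congr rfl (fun a _ => Finset.sum_congr rfl (fun f _ => Finset.sum_comm))

/-! ### §5.3 Half-decimations and the SANDWICH identity `dec M (K · avgLift M V · K′) = dec M K · V · dec M K′` -/

/-- Row re-indexing: a fine sum of `ρ u` against the sublattice-supported lift of `φ`. [folklore] -/
theorem tsum_mul_sublattice (M : ℕ) [NeZero M] (off : Fin (d + 1) → ℤ) (ρ φ : (Fin (d + 1) → ℤ) → ℝ) :
    ∑' u : Fin (d + 1) → ℤ, ρ u * (if Torus.proj M (u - off) = 0 then φ (quo M (u - off)) else 0) =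
      ∑' s, ρ ((M : ℤ) • s + off) * φ s := by
  refine (tsum_congr fun u => ?_).trans (tsum_sublattice M off (fun s => ρ ((M : ℤ) • s + off) * φ s))
  by_cases h : Torus.proj M (u - off) = 0
  · simp only [h, if_true, eq_zsmul_quo_add_off h]
  · simp only [h, if_false, mul_zero]

/-- Summability for the row re-indexing. [folklore] -/
theorem summable_mul_sublattice (M : ℕ) [NeZero M] (off : Fin (d + 1) → ℤ) (ρ φ : (Fin (d + 1) → ℤ) → ℝ)
    (h : Summable (fun s => ρ ((M : ℤ) • s + off) * φ s)) :
    Summable (fun u : Fin (d + 1) → ℤ => ρ u * (if Torus.proj M (u - off) = 0 then φ (quo M (u - off)) else 0)) := by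
  refine (summable_sublattice M off h).congr (fun u => ?_)
  by_cases h0 : Torus.proj M (u - off) = 0
  · simp only [h0, if_true, eq_zsmul_quo_add_off h0]
  · simp only [h0, if_false, mul_zero]

/-- Bounded times exponentially localised is summable. [folklore] -/
theorem summable_bdd_mul_decay {ρ φ : (Fin (d + 1) → ℤ) → ℝ} {Cρ Cφ δ : ℝ} {q : Fin (d + 1) → ℤ} (hρ : ∀ t, |ρ t| ≤ Cρ)
    (hφ : ∀ t, |φ t| ≤ Cφ * Real.exp (-δ * l1 (t - q))) (hδ : 0 < δ) : Summable (fun t => ρ t * φ t) := by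
  have hCρ : 0 ≤ Cρ := (abs_nonneg _).trans (hρ q)
  refine Summable.of_norm_bounded ((summable_exp_shift' hδ q).mul_left (Cρ * Cφ)) (fun t => ?_)
  rw [Real.norm_eq_abs, abs_mul]
  calc |ρ t| * |φ t| ≤ Cρ * (Cφ * Real.exp (-δ * l1 (t - q))) := mul_le_mul (hρ t) (hφ t) (abs_nonneg _) hCρ
    _ = Cρ * Cφ * Real.exp (-δ * l1 (t - q)) := by ring

/-- A bounded row against the left leg of a bi-localised kernel is summable. [folklore] -/
theorem summable_bdd_mul_biLoc {V : ExpKernelCalculus.MKer (d + 1) (Fib d)} {p q : Fin (d + 1) → ℤ} {CV δV : ℝ}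
    (hV : BiLoc V p q CV δV) (hδV : 0 < δV) {ρ : (Fin (d + 1) → ℤ) → ℝ} {Cρ : ℝ} (hρ : ∀ s, |ρ s| ≤ Cρ)
    (t : Fin (d + 1) → ℤ) (g f : Fib d) : Summable (fun s => ρ s * V s t g f) := by
  have hCV : 0 ≤ CV := hV.nonneg (Sum.inl 0)
  refine summable_bdd_mul_decay (q := p) (Cφ := CV) hρ (fun s => (hV s t g f).trans ?_) hδV
  refine mul_le_mul_of_nonneg_left (Real.exp_le_exp.2 ?_) hCV
  nlinarith [l1_nonneg (t - q), l1_nonneg (s - p)]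

/-- The corresponding sum is exponentially localised in the right leg. [folklore] -/
theorem abs_tsum_bdd_mul_biLoc_le {V : ExpKernelCalculus.MKer (d + 1) (Fib d)} {p q : Fin (d + 1) → ℤ} {CV δV : ℝ}
    (hV : BiLoc V p q CV δV) (hδV : 0 < δV) {ρ : (Fin (d + 1) → ℤ) → ℝ} {Cρ : ℝ} (hρ : ∀ s, |ρ s| ≤ Cρ)
    (t : Fin (d + 1) → ℤ) (g f : Fib d) :
    |∑' s, ρ s * V s t g f| ≤ Cρ * CV * Zl (d + 1) δV * Real.exp (-δV * l1 (t - q)) := by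
  have hCρ : 0 ≤ Cρ := (abs_nonneg _).trans (hρ 0)
  have hs : Summable (fun s => Cρ * CV * Real.exp (-δV * l1 (t - q)) * Real.exp (-δV * l1 (s - p))) :=
    (summable_exp_shift' hδV p).mul_left _
  have hb : ∀ s, ‖ρ s * V s t g f‖ ≤ Cρ * CV * Real.exp (-δV * l1 (t - q)) * Real.exp (-δV * l1 (s - p)) := by
    intro s
    rw [Real.norm_eq_abs, abs_mul]
    have e : Real.exp (-δV * (l1 (s - p) + l1 (t - q))) = Real.exp (-δV * l1 (t - q)) * Real.exp (-δV * l1 (s - p)) := by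
      rw [← Real.exp_add]; congr 1; ring
    calc |ρ s| * |V s t g f| ≤ Cρ * (CV * Real.exp (-δV * (l1 (s - p) + l1 (t - q)))) :=
          mul_le_mul (hρ s) (hV s t g f) (abs_nonneg _) hCρ
      _ = Cρ * CV * Real.exp (-δV * l1 (t - q)) * Real.exp (-δV * l1 (s - p)) := by rw [e]; ring
  rw [← Real.norm_eq_abs]
  calc ‖∑' s, ρ s * V s t g f‖ ≤ ∑' s, Cρ * CV * Real.exp (-δV * l1 (t - q)) * Real.exp (-δV * l1 (s - p)) :=
        tsum_of_norm_bounded hs.hasSum hb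
    _ = Cρ * CV * Zl (d + 1) δV * Real.exp (-δV * l1 (t - q)) := by rw [tsum_mul_left, tsum_exp_shift']; ring

/-- RIGHT HALF-DECIMATION `K Q′ᵀ`: the right leg of a fine kernel averaged onto the coarse legs. [folklore] -/
def rdec (M : ℕ) (K : ExpKernelCalculus.MKer (d + 1) (Fib d)) : ExpKernelCalculus.MKer (d + 1) (Fib d) :=
  fun x s a g => ∑ k ∈ legSet d M g, legW d M g * K x (legPt M g s k) a g

/-- LEFT HALF-DECIMATION `Q′ K`: the left leg of a fine kernel averaged onto the coarse legs. [folklore] -/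
def ldec (M : ℕ) (K : ExpKernelCalculus.MKer (d + 1) (Fib d)) : ExpKernelCalculus.MKer (d + 1) (Fib d) :=
  fun t w f b => ∑ k ∈ legSet d M f, legW d M f * K (legPt M f t k) w f b

/-- RIGHT LIFT `H Q′` of a kernel whose right leg is coarse, onto a fine right leg. [folklore] -/
def rlift (M : ℕ) (H : ExpKernelCalculus.MKer (d + 1) (Fib d)) : ExpKernelCalculus.MKer (d + 1) (Fib d) :=
  fun x y a f => ∑ k ∈ legSet d M f, legW d M f *
    (if Torus.proj M (y - legOff M f k) = 0 then H x (quo M (y - legOff M f k)) a f else 0)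

/-- `Q′ (K Q′ᵀ) = Q′ K Q′ᵀ`: left-averaging the right half-decimation gives the decimation. [folklore] -/
theorem sum_legW_mul_rdec (M : ℕ) (K : ExpKernelCalculus.MKer (d + 1) (Fib d)) (z' s : Fin (d + 1) → ℤ) (a g : Fib d) :
    ∑ i ∈ legSet d M a, legW d M a * rdec M K (legPt M a z' i) s a g = dec M K z' s a g := by
  simp only [rdec, dec, Finset.mul_sum]
  exact Finset.sum_congr rfl (fun i _ => Finset.sum_congr rfl (fun k _ => by ring))

/-- `(Q′ K) Q′ᵀ = Q′ K Q′ᵀ`: right-averaging the left half-decimation gives the decimation. [folklore] -/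
theorem sum_legW_mul_ldec (M : ℕ) (K : ExpKernelCalculus.MKer (d + 1) (Fib d)) (t z'' : Fin (d + 1) → ℤ) (f b : Fib d) :
    ∑ i ∈ legSet d M b, legW d M b * ldec M K t (legPt M b z'' i) f b = dec M K t z'' f b := by
  simp only [ldec, dec, Finset.mul_sum]
  rw [Finset.sum_comm]
  exact Finset.sum_congr rfl (fun k _ => Finset.sum_congr rfl (fun i _ => by ring))

/-- The right half-decimation of a bounded kernel is bounded by the same constant (the weights sum to one). [folklore] -/
theorem abs_rdec_le (M : ℕ) [NeZero M] {K : ExpKernelCalculus.MKer (d + 1) (Fib d)} {CK : ℝ} (bK : ∀ x y a b, |K x y a b| ≤ CK)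
    (x s : Fin (d + 1) → ℤ) (a g : Fib d) : |rdec M K x s a g| ≤ CK := by
  unfold rdec
  calc |∑ k ∈ legSet d M g, legW d M g * K x (legPt M g s k) a g|
      ≤ ∑ k ∈ legSet d M g, |legW d M g * K x (legPt M g s k) a g| := Finset.abs_sum_le_sum_abs _ _
    _ ≤ ∑ k ∈ legSet d M g, legW d M g * CK := Finset.sum_le_sum (fun k _ => by
        rw [abs_mul, abs_of_nonneg (legW_nonneg M g)]
        exact mul_le_mul_of_nonneg_left (bK _ _ _ _) (legW_nonneg M g))
    _ = CK := by rw [← Finset.sum_mul, sum_legW (d := d) (NeZero.ne M) g, one_mul]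

/-- The left half-decimation of a bounded kernel is bounded by the same constant. [folklore] -/
theorem abs_ldec_le (M : ℕ) [NeZero M] {K : ExpKernelCalculus.MKer (d + 1) (Fib d)} {CK : ℝ} (bK : ∀ x y a b, |K x y a b| ≤ CK)
    (t w : Fin (d + 1) → ℤ) (f b : Fib d) : |ldec M K t w f b| ≤ CK := by
  unfold ldec
  calc |∑ k ∈ legSet d M f, legW d M f * K (legPt M f t k) w f b|
      ≤ ∑ k ∈ legSet d M f, |legW d M f * K (legPt M f t k) w f b| := Finset.abs_sum_le_sum_abs _ _
    _ ≤ ∑ k ∈ legSet d M f, legW d M f * CK := Finset.sum_le_sum (fun k _ => by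
        rw [abs_mul, abs_of_nonneg (legW_nonneg M f)]
        exact mul_le_mul_of_nonneg_left (bK _ _ _ _) (legW_nonneg M f))
    _ = CK := by rw [← Finset.sum_mul, sum_legW (d := d) (NeZero.ne M) f, one_mul]

/-- `(K Q′ᵀ) V` is exponentially localised in its (coarse) right leg when `K` is bounded and `V` bi-localised. [folklore] -/
theorem abs_comp_rdec_le (M : ℕ) [NeZero M] {K V : ExpKernelCalculus.MKer (d + 1) (Fib d)} {CK CV δV : ℝ}
    {p q : Fin (d + 1) → ℤ} (bK : ∀ x y a b, |K x y a b| ≤ CK) (hV : BiLoc V p q CV δV) (hδV : 0 < δV)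
    (x t : Fin (d + 1) → ℤ) (a f : Fib d) :
    |comp (rdec M K) V x t a f| ≤ (Fintype.card (Fib d) : ℝ) * (CK * CV * Zl (d + 1) δV) * Real.exp (-δV * l1 (t - q)) := by
  have sm : ∀ g, Summable (fun s => rdec M K x s a g * V s t g f) :=
    fun g => summable_bdd_mul_biLoc hV hδV (fun s => abs_rdec_le M bK x s a g) t g f
  unfold comp
  rw [Summable.tsum_finsetSum (fun g _ => sm g)]
  calc |∑ g, ∑' s, rdec M K x s a g * V s t g f| ≤ ∑ g : Fib d, |∑' s, rdec M K x s a g * V s t g f| :=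
        Finset.abs_sum_le_sum_abs _ _
    _ ≤ ∑ g : Fib d, CK * CV * Zl (d + 1) δV * Real.exp (-δV * l1 (t - q)) :=
        Finset.sum_le_sum (fun g _ => abs_tsum_bdd_mul_biLoc_le hV hδV (fun s => abs_rdec_le M bK x s a g) t g f)
    _ = (Fintype.card (Fib d) : ℝ) * (CK * CV * Zl (d + 1) δV) * Real.exp (-δV * l1 (t - q)) := by
        rw [Finset.sum_const, nsmul_eq_mul, Finset.card_univ]; ring

/-- **STEP 1 of the sandwich**: `K (Q′ᵀ V Q′) = ((K Q′ᵀ) V) Q′`, i.e. `comp K (avgLift M V) = rlift M (comp (rdec M K) V)`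
(bounded `K`, bi-localised `V`). [folklore] -/
theorem comp_avgLift_eq_rlift (M : ℕ) [NeZero M] {K V : ExpKernelCalculus.MKer (d + 1) (Fib d)} {CK CV δV : ℝ}
    {p q : Fin (d + 1) → ℤ} (bK : ∀ x y a b, |K x y a b| ≤ CK) (hV : BiLoc V p q CV δV) (hδV : 0 < δV) :
    comp K (avgLift M V) = rlift M (comp (rdec M K) V) := by
  funext x y a f
  -- pointwise normal form of the LHS summand
  have pt : ∀ (g : Fib d) (k k' : (Fin (d + 1) → ℕ) × ℕ) (u : Fin (d + 1) → ℤ),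
      K x u a g * (legW d M g * legW d M f *
        (if Torus.proj M (u - legOff M g k) = 0 ∧ Torus.proj M (y - legOff M f k') = 0 then
          V (quo M (u - legOff M g k)) (quo M (y - legOff M f k')) g f else 0)) =
      if Torus.proj M (y - legOff M f k') = 0 then
        K x u a g * (if Torus.proj M (u - legOff M g k) = 0 then
          (fun s => legW d M g * legW d M f * V s (quo M (y - legOff M f k')) g f) (quo M (u - legOff M g k)) else 0)
      else 0 := by
    intro g k k' u
    by_cases hy : Torus.proj M (y - legOff M f k') = 0
    · by_cases hu : Torus.proj M (u - legOff M g k) = 0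
      · simp only [hy, hu, and_self, if_true]
      · simp only [hy, hu, false_and, if_false, if_true, mul_zero]
    · simp only [hy, and_false, if_false, mul_zero]
  have sm : ∀ (g : Fib d) (k k' : (Fin (d + 1) → ℕ) × ℕ), Summable (fun u => K x u a g * (legW d M g * legW d M f *
        (if Torus.proj M (u - legOff M g k) = 0 ∧ Torus.proj M (y - legOff M f k') = 0 then
          V (quo M (u - legOff M g k)) (quo M (y - legOff M f k')) g f else 0))) := by
    intro g k k'
    by_cases hy : Torus.proj M (y - legOff M f k') = 0
    · have h1 : Summable (fun s => K x ((M : ℤ) • s + legOff M g k) a g *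
          (legW d M g * legW d M f * V s (quo M (y - legOff M f k')) g f)) :=
        ((summable_bdd_mul_biLoc hV hδV (ρ := fun s => K x ((M : ℤ) • s + legOff M g k) a g) (fun s => bK _ _ _ _)
          (quo M (y - legOff M f k')) g f).mul_left (legW d M g * legW d M f)).congr (fun s => by ring)
      refine (summable_mul_sublattice M (legOff M g k) (fun u => K x u a g)
        (fun s => legW d M g * legW d M f * V s (quo M (y - legOff M f k')) g f) h1).congr (fun u => ?_)
      rw [pt g k k' u]
      simp only [hy, if_true]
    · refine summable_zero.congr (fun u => ?_)
      rw [pt g k k' u]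
      simp only [hy, if_false]
  -- LHS, per term
  have lhs2 : ∀ (g : Fib d) (k k' : (Fin (d + 1) → ℕ) × ℕ), (∑' u, K x u a g * (legW d M g * legW d M f *
        (if Torus.proj M (u - legOff M g k) = 0 ∧ Torus.proj M (y - legOff M f k') = 0 then
          V (quo M (u - legOff M g k)) (quo M (y - legOff M f k')) g f else 0))) =
      if Torus.proj M (y - legOff M f k') = 0 then
        ∑' s, K x (legPt M g s k) a g * (legW d M g * legW d M f * V s (quo M (y - legOff M f k')) g f) else 0 := by
    intro g k k'
    rw [tsum_congr (pt g k k')]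
    by_cases hy : Torus.proj M (y - legOff M f k') = 0
    · simp only [hy, if_true]
      refine (tsum_mul_sublattice M (legOff M g k) (fun u => K x u a g)
        (fun s => legW d M g * legW d M f * V s (quo M (y - legOff M f k')) g f)).trans ?_
      exact tsum_congr (fun s => by simp only [legPt_eq_add_legOff])
    · simp only [hy, if_false, tsum_zero]
  have lhs3 : (∑' u, ∑ g, K x u a g * avgLift M V u y g f) = ∑ g : Fib d, ∑ k ∈ legSet d M g, ∑ k' ∈ legSet d M f,
      (if Torus.proj M (y - legOff M f k') = 0 then
        ∑' s, K x (legPt M g s k) a g * (legW d M g * legW d M f * V s (quo M (y - legOff M f k')) g f) else 0) := by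
    have ex : (fun u => ∑ g, K x u a g * avgLift M V u y g f) = fun u => ∑ g, ∑ k ∈ legSet d M g, ∑ k' ∈ legSet d M f,
        K x u a g * (legW d M g * legW d M f *
          (if Torus.proj M (u - legOff M g k) = 0 ∧ Torus.proj M (y - legOff M f k') = 0 then
            V (quo M (u - legOff M g k)) (quo M (y - legOff M f k')) g f else 0)) := by
      funext u
      refine Finset.sum_congr rfl (fun g _ => ?_)
      simp only [avgLift, Finset.mul_sum]
    rw [ex, Summable.tsum_finsetSum (fun g _ => summable_sum (fun k _ => summable_sum (fun k' _ => sm g k k')))]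
    refine Finset.sum_congr rfl (fun g _ => ?_)
    rw [Summable.tsum_finsetSum (fun k _ => summable_sum (fun k' _ => sm g k k'))]
    refine Finset.sum_congr rfl (fun k _ => ?_)
    rw [Summable.tsum_finsetSum (fun k' _ => sm g k k')]
    exact Finset.sum_congr rfl (fun k' _ => lhs2 g k k')
  -- RHS, per term
  have rhs2 : ∀ k' : (Fin (d + 1) → ℕ) × ℕ, legW d M f * (if Torus.proj M (y - legOff M f k') = 0 then
      comp (rdec M K) V x (quo M (y - legOff M f k')) a f else 0) =
      ∑ g : Fib d, ∑ k ∈ legSet d M g, (if Torus.proj M (y - legOff M f k') = 0 then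
        ∑' s, K x (legPt M g s k) a g * (legW d M g * legW d M f * V s (quo M (y - legOff M f k')) g f) else 0) := by
    intro k'
    by_cases hy : Torus.proj M (y - legOff M f k') = 0
    · simp only [hy, if_true, comp]
      have smk : ∀ (g : Fib d) (k : (Fin (d + 1) → ℕ) × ℕ),
          Summable (fun s => legW d M g * K x (legPt M g s k) a g * V s (quo M (y - legOff M f k')) g f) :=
        fun g k => summable_bdd_mul_biLoc hV hδV (ρ := fun s => legW d M g * K x (legPt M g s k) a g)
          (fun s => by
            rw [abs_mul, abs_of_nonneg (legW_nonneg M g)]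
            exact mul_le_mul_of_nonneg_left (bK _ _ _ _) (legW_nonneg M g)) _ g f
      have e1 : (fun s => ∑ g, rdec M K x s a g * V s (quo M (y - legOff M f k')) g f) =
          fun s => ∑ g, ∑ k ∈ legSet d M g, legW d M g * K x (legPt M g s k) a g * V s (quo M (y - legOff M f k')) g f := by
        funext s
        refine Finset.sum_congr rfl (fun g _ => ?_)
        simp only [rdec, Finset.sum_mul]
      rw [e1, Summable.tsum_finsetSum (fun g _ => summable_sum (fun k _ => smk g k)), Finset.mul_sum]
      refine Finset.sum_congr rfl (fun g _ => ?_)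
      rw [Summable.tsum_finsetSum (fun k _ => smk g k), Finset.mul_sum]
      refine Finset.sum_congr rfl (fun k _ => ?_)
      rw [← tsum_mul_left]
      exact tsum_congr (fun s => by ring)
    · simp only [hy, if_false, mul_zero, Finset.sum_const_zero]
  have rhs3 : rlift M (comp (rdec M K) V) x y a f = ∑ g : Fib d, ∑ k ∈ legSet d M g, ∑ k' ∈ legSet d M f,
      (if Torus.proj M (y - legOff M f k') = 0 then
        ∑' s, K x (legPt M g s k) a g * (legW d M g * legW d M f * V s (quo M (y - legOff M f k')) g f) else 0) := by
    simp only [rlift]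
    rw [Finset.sum_congr rfl (fun k' _ => rhs2 k'), Finset.sum_comm]
    exact Finset.sum_congr rfl (fun g _ => Finset.sum_comm)
  simp only [comp] at lhs3 ⊢
  rw [lhs3, rhs3]

/-- **STEP 2 of the sandwich**: `(H Q′) K′ = H (Q′ K′)`, i.e. `comp (rlift M H) K′ = comp H (ldec M K′)` (right leg of `H`
exponentially localised, `K′` bounded). [folklore] -/
theorem comp_rlift_eq (M : ℕ) [NeZero M] {H K' : ExpKernelCalculus.MKer (d + 1) (Fib d)} {CH δH CK' : ℝ}
    {q : Fin (d + 1) → ℤ} (hH : ∀ x t a f, |H x t a f| ≤ CH * Real.exp (-δH * l1 (t - q))) (hδH : 0 < δH)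
    (bK' : ∀ x y a b, |K' x y a b| ≤ CK') :
    comp (rlift M H) K' = comp H (ldec M K') := by
  funext x w a b
  have bW : ∀ (f : Fib d) (ψ : (Fin (d + 1) → ℤ) → Fin (d + 1) → ℤ) (t : Fin (d + 1) → ℤ),
      |legW d M f * K' (ψ t) w f b| ≤ legW d M f * CK' := fun f ψ t => by
    rw [abs_mul, abs_of_nonneg (legW_nonneg M f)]
    exact mul_le_mul_of_nonneg_left (bK' _ _ _ _) (legW_nonneg M f)
  have smT : ∀ (f : Fib d) (k : (Fin (d + 1) → ℕ) × ℕ),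
      Summable (fun t => legW d M f * K' ((M : ℤ) • t + legOff M f k) w f b * H x t a f) :=
    fun f k => summable_bdd_mul_decay (bW f (fun t => (M : ℤ) • t + legOff M f k)) (fun t => hH x t a f) hδH
  have sm : ∀ (f : Fib d) (k : (Fin (d + 1) → ℕ) × ℕ), Summable (fun y => legW d M f *
      (if Torus.proj M (y - legOff M f k) = 0 then H x (quo M (y - legOff M f k)) a f else 0) * K' y w f b) :=
    fun f k => (summable_mul_sublattice M (legOff M f k) (fun y => legW d M f * K' y w f b) (fun t => H x t a f)
      (smT f k)).congr (fun y => by ring)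
  have smR : ∀ (f : Fib d) (k : (Fin (d + 1) → ℕ) × ℕ),
      Summable (fun t => H x t a f * (legW d M f * K' (legPt M f t k) w f b)) :=
    fun f k => (summable_bdd_mul_decay (bW f (fun t => legPt M f t k)) (fun t => hH x t a f) hδH).congr
      (fun t => by ring)
  simp only [comp, rlift, ldec]
  -- LHS
  have exL : (fun y => ∑ f, (∑ k ∈ legSet d M f, legW d M f *
      (if Torus.proj M (y - legOff M f k) = 0 then H x (quo M (y - legOff M f k)) a f else 0)) * K' y w f b) =
      fun y => ∑ f, ∑ k ∈ legSet d M f, legW d M f *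
        (if Torus.proj M (y - legOff M f k) = 0 then H x (quo M (y - legOff M f k)) a f else 0) * K' y w f b := by
    funext y
    exact Finset.sum_congr rfl (fun f _ => Finset.sum_mul _ _ _)
  have exR : (fun t => ∑ f, H x t a f * ∑ k ∈ legSet d M f, legW d M f * K' (legPt M f t k) w f b) =
      fun t => ∑ f, ∑ k ∈ legSet d M f, H x t a f * (legW d M f * K' (legPt M f t k) w f b) := by
    funext t
    exact Finset.sum_congr rfl (fun f _ => Finset.mul_sum _ _ _)
  rw [exL, exR, Summable.tsum_finsetSum (fun f _ => summable_sum (fun k _ => sm f k)),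
    Summable.tsum_finsetSum (fun f _ => summable_sum (fun k _ => smR f k))]
  refine Finset.sum_congr rfl (fun f _ => ?_)
  rw [Summable.tsum_finsetSum (fun k _ => sm f k), Summable.tsum_finsetSum (fun k _ => smR f k)]
  refine Finset.sum_congr rfl (fun k _ => ?_)
  calc (∑' y, legW d M f * (if Torus.proj M (y - legOff M f k) = 0 then H x (quo M (y - legOff M f k)) a f else 0) *
          K' y w f b)
      = ∑' y, (legW d M f * K' y w f b) *
          (if Torus.proj M (y - legOff M f k) = 0 then H x (quo M (y - legOff M f k)) a f else 0) :=
        tsum_congr (fun y => by ring)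
    _ = ∑' t, (legW d M f * K' ((M : ℤ) • t + legOff M f k) w f b) * H x t a f :=
        tsum_mul_sublattice M (legOff M f k) (fun y => legW d M f * K' y w f b) (fun t => H x t a f)
    _ = ∑' t, H x t a f * (legW d M f * K' (legPt M f t k) w f b) :=
        tsum_congr (fun t => by rw [legPt_eq_add_legOff]; ring)

/-- **STEP 3 of the sandwich**: `Q′ (((K Q′ᵀ) V) (Q′ K′)) Q′ᵀ = ((Q′KQ′ᵀ) V) (Q′K′Q′ᵀ)`, i.e.
`dec M (comp (comp (rdec M K) V) (ldec M K′)) = comp (comp (dec M K) V) (dec M K′)` (bounded `K`, `K′`, bi-localised `V`).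
[folklore] -/
theorem dec_comp_rdec_ldec (M : ℕ) [NeZero M] {K K' V : ExpKernelCalculus.MKer (d + 1) (Fib d)} {CK CK' CV δV : ℝ}
    {p q : Fin (d + 1) → ℤ} (bK : ∀ x y a b, |K x y a b| ≤ CK) (bK' : ∀ x y a b, |K' x y a b| ≤ CK')
    (hV : BiLoc V p q CV δV) (hδV : 0 < δV) :
    dec M (comp (comp (rdec M K) V) (ldec M K')) = comp (comp (dec M K) V) (dec M K') := by
  funext z' z'' a b
  -- inner linearity: `((Q′KQ′ᵀ) V)(z′, t) = Σ_i legW a · ((KQ′ᵀ) V)(legPt a z′ i, t)`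
  have smI : ∀ (i : (Fin (d + 1) → ℕ) × ℕ) (t : Fin (d + 1) → ℤ) (g f : Fib d),
      Summable (fun s => legW d M a * rdec M K (legPt M a z' i) s a g * V s t g f) :=
    fun i t g f => summable_bdd_mul_biLoc hV hδV (ρ := fun s => legW d M a * rdec M K (legPt M a z' i) s a g)
      (fun s => by
        rw [abs_mul, abs_of_nonneg (legW_nonneg M a)]
        exact mul_le_mul_of_nonneg_left (abs_rdec_le M bK _ s a g) (legW_nonneg M a)) t g f
  have inner : ∀ (t : Fin (d + 1) → ℤ) (f : Fib d), comp (dec M K) V z' t a f =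
      ∑ i ∈ legSet d M a, legW d M a * comp (rdec M K) V (legPt M a z' i) t a f := by
    intro t f
    simp only [comp]
    have e1 : (fun s => ∑ g, dec M K z' s a g * V s t g f) =
        fun s => ∑ g, ∑ i ∈ legSet d M a, legW d M a * rdec M K (legPt M a z' i) s a g * V s t g f := by
      funext s
      refine Finset.sum_congr rfl (fun g _ => ?_)
      rw [← sum_legW_mul_rdec, Finset.sum_mul]
    rw [e1, Summable.tsum_finsetSum (fun g _ => summable_sum (fun i _ => smI i t g f))]
    rw [show (∑ g : Fib d, ∑' s, ∑ i ∈ legSet d M a, legW d M a * rdec M K (legPt M a z' i) s a g * V s t g f) =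
        ∑ g : Fib d, ∑ i ∈ legSet d M a, ∑' s, legW d M a * rdec M K (legPt M a z' i) s a g * V s t g f from
      Finset.sum_congr rfl (fun g _ => Summable.tsum_finsetSum (fun i _ => smI i t g f))]
    rw [Finset.sum_comm, ]
    refine Finset.sum_congr rfl (fun i _ => ?_)
    have smg : ∀ g : Fib d, Summable (fun s => rdec M K (legPt M a z' i) s a g * V s t g f) :=
      fun g => summable_bdd_mul_biLoc hV hδV (fun s => abs_rdec_le M bK _ s a g) t g f
    rw [Summable.tsum_finsetSum (fun g _ => smg g), Finset.mul_sum]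
    refine Finset.sum_congr rfl (fun g _ => ?_)
    rw [← tsum_mul_left]
    exact tsum_congr (fun s => by ring)
  -- outer summability: `t ↦ (legW a · A_i t f) · (legW b · B_i'' t f)`
  have smO : ∀ (i i'' : (Fin (d + 1) → ℕ) × ℕ) (f : Fib d), Summable (fun t =>
      (legW d M a * comp (rdec M K) V (legPt M a z' i) t a f) * (legW d M b * ldec M K' t (legPt M b z'' i'') f b)) := by
    intro i i'' f
    refine (summable_bdd_mul_decay (ρ := fun t => legW d M b * ldec M K' t (legPt M b z'' i'') f b)
      (φ := fun t => legW d M a * comp (rdec M K) V (legPt M a z' i) t a f) (Cρ := legW d M b * CK')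
      (Cφ := legW d M a * ((Fintype.card (Fib d) : ℝ) * (CK * CV * Zl (d + 1) δV))) (q := q) (δ := δV)
      (fun t => ?_) (fun t => ?_) hδV).congr (fun t => by ring)
    · rw [abs_mul, abs_of_nonneg (legW_nonneg M b)]
      exact mul_le_mul_of_nonneg_left (abs_ldec_le M bK' t _ f b) (legW_nonneg M b)
    · rw [abs_mul, abs_of_nonneg (legW_nonneg M a), mul_assoc]
      exact mul_le_mul_of_nonneg_left (abs_comp_rdec_le M bK hV hδV _ t a f) (legW_nonneg M a)
  -- RHS → LHS
  symm
  calc comp (comp (dec M K) V) (dec M K') z' z'' a b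
      = ∑' t, ∑ f, (∑ i ∈ legSet d M a, legW d M a * comp (rdec M K) V (legPt M a z' i) t a f) *
          (∑ i'' ∈ legSet d M b, legW d M b * ldec M K' t (legPt M b z'' i'') f b) := by
        show (∑' t, ∑ f, comp (dec M K) V z' t a f * dec M K' t z'' f b) = _
        exact tsum_congr (fun t => Finset.sum_congr rfl (fun f _ => by rw [inner t f, sum_legW_mul_ldec]))
    _ = ∑' t, ∑ i ∈ legSet d M a, ∑ i'' ∈ legSet d M b, ∑ f,
          (legW d M a * comp (rdec M K) V (legPt M a z' i) t a f) * (legW d M b * ldec M K' t (legPt M b z'' i'') f b) := by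
        refine tsum_congr (fun t => ?_)
        rw [Finset.sum_congr rfl (fun f _ => Finset.sum_mul_sum _ _ _ _), Finset.sum_comm]
        exact Finset.sum_congr rfl (fun i _ => Finset.sum_comm)
    _ = ∑ i ∈ legSet d M a, ∑ i'' ∈ legSet d M b, ∑' t, ∑ f,
          (legW d M a * comp (rdec M K) V (legPt M a z' i) t a f) * (legW d M b * ldec M K' t (legPt M b z'' i'') f b) := by
        rw [Summable.tsum_finsetSum (fun i _ => summable_sum (fun i'' _ => summable_sum (fun f _ => smO i i'' f)))]
        refine Finset.sum_congr rfl (fun i _ => ?_)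
        rw [Summable.tsum_finsetSum (fun i'' _ => summable_sum (fun f _ => smO i i'' f))]
    _ = dec M (comp (comp (rdec M K) V) (ldec M K')) z' z'' a b := by
        simp only [dec]
        refine Finset.sum_congr rfl (fun i _ => Finset.sum_congr rfl (fun i'' _ => ?_))
        show _ = legW d M a * legW d M b * (∑' t, ∑ f, comp (rdec M K) V (legPt M a z' i) t a f *
          ldec M K' t (legPt M b z'' i'') f b)
        rw [← tsum_mul_left]
        refine tsum_congr (fun t => ?_)
        rw [Finset.mul_sum]
        exact Finset.sum_congr rfl (fun f _ => by ring)

/-- **THE SANDWICH IDENTITY** `Q′ (K (Q′ᵀVQ′) K′) Q′ᵀ = (Q′KQ′ᵀ) V (Q′K′Q′ᵀ)`: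
`dec M (comp (comp K (avgLift M V)) K′) = comp (comp (dec M K) V) (dec M K′)` for decaying fine kernels `K`, `K′` and a
bi-localised coarse kernel `V`.  Use ((D-μ)): with `K = K′ =` a fluctuation covariance, BUBBLES with averaging-lifted step jets are
step-level bubbles against the decimated covariance (`bubble (dec M K) V W`-type terms), the partner of `tadpole_avgLift`. [folklore] -/
theorem dec_comp_avgLift_comp (M : ℕ) [NeZero M] {K K' V : ExpKernelCalculus.MKer (d + 1) (Fib d)}
    {CK δK CK' δK' CV δV : ℝ} {p q : Fin (d + 1) → ℤ} (hK : Decays K CK δK) (hδK : 0 ≤ δK) (hK' : Decays K' CK' δK')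
    (hδK' : 0 ≤ δK') (hV : BiLoc V p q CV δV) (hδV : 0 < δV) :
    dec M (comp (comp K (avgLift M V)) K') = comp (comp (dec M K) V) (dec M K') := by
  have hCK : 0 ≤ CK := hK.nonneg (Sum.inl 0)
  have hCK' : 0 ≤ CK' := hK'.nonneg (Sum.inl 0)
  have bK : ∀ x y a b, |K x y a b| ≤ CK := fun x y a b =>
    (hK x y a b).trans (mul_le_of_le_one_right hCK (Real.exp_le_one_iff.mpr (by nlinarith [l1_nonneg (x - y)])))
  have bK' : ∀ x y a b, |K' x y a b| ≤ CK' := fun x y a b =>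
    (hK' x y a b).trans (mul_le_of_le_one_right hCK' (Real.exp_le_one_iff.mpr (by nlinarith [l1_nonneg (x - y)])))
  rw [comp_avgLift_eq_rlift M bK hV hδV, comp_rlift_eq M (abs_comp_rdec_le M bK hV hδV) hδV bK',
    dec_comp_rdec_ldec M bK bK' hV hδV]

end AvgLift

/-! ## §6 (v1.1) The WEIGHTED lift `liftW` — unit bookkeeping for the inter-level identities

`OneStepKernelFamily.dec M` and `avgLift M` (§5) read FIELD legs with the MEAN weight `legW d M (inl _) = (M^(d+2))⁻¹`
(`sum_legW = 1`), while the one-shot packed resolvent's multiplier legs are dual to an UNNORMALISED contour sum (weight `1`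
per leg).  An identity composing a level-`M` kernel with a decimated kernel through `lift M s t` therefore needs ONE factor
`M^(d+2)` per FIELD-type slot (`slot true`) of the lift (finding X-an4-37 of the an4 lineage, a total-mass count; recorded in
`BETA/AN2.md` §25).  `liftW M s t K := slotW d M s · slotW d M t · lift M s t K` packages exactly these factors, so that the
composition identities can be stated over one tree declaration without ad-hoc scalars.  Abstract bookkeeping only; which
powers Bałaban's data actually carry is decided where the data are instantiated, not here. -/

section LiftW

open Literature.MathematicalPhysics.QuantumFieldTheory.Balaban1983to89.Beta.OneStepKernelFamily (legW)

variable {d : ℕ}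

/-- The UNIT FACTOR of a slot type: `M^(d+2)` (= the number of legs of one coarse bond's contour sum = `(legW d M (inl _))⁻¹`)
for a field-type slot `s = true`, `1` for a multiplier-type slot `s = false`. [folklore] -/
def slotW (d M : ℕ) (s : Bool) : ℝ := if s then (M : ℝ) ^ (d + 2) else 1

/-- PIN. [folklore] -/
theorem slotW_true (d M : ℕ) : slotW d M true = (M : ℝ) ^ (d + 2) := rfl

/-- PIN. [folklore] -/
theorem slotW_false (d M : ℕ) : slotW d M false = 1 := rfl

/-- `1 ≤ slotW` for `M ≠ 0`. [folklore] -/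
theorem one_le_slotW (d M : ℕ) [NeZero M] (s : Bool) : 1 ≤ slotW d M s := by
  cases s
  · simp [slotW]
  · simp only [slotW, if_true]
    have hM : (1 : ℝ) ≤ M := by exact_mod_cast Nat.one_le_iff_ne_zero.mpr (NeZero.ne M)
    exact one_le_pow₀ hM

/-- `0 ≤ slotW`. [folklore] -/
theorem slotW_nonneg (d M : ℕ) (s : Bool) : 0 ≤ slotW d M s := by
  cases s
  · simp [slotW]
  · simp only [slotW, if_true]; positivity

/-- The field-slot factor is the reciprocal of the mean leg weight: `slotW d M true * legW d M (inl κ) = 1`. [folklore] -/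
theorem slotW_true_mul_legW (d M : ℕ) [NeZero M] (κ : Fin (d + 1)) :
    slotW d M true * legW d M (Sum.inl κ) = 1 := by
  have hM : (M : ℝ) ≠ 0 := by exact_mod_cast NeZero.ne M
  simp only [slotW, if_true, legW]
  rw [mul_inv_cancel₀ (pow_ne_zero _ hM)]

/-- **THE WEIGHTED LIFT** `liftW M s t K := slotW s · slotW t · lift M s t K`. [folklore] -/
def liftW (M : ℕ) (s t : Bool) (K : ExpKernelCalculus.MKer (d + 1) (Fib d)) : ExpKernelCalculus.MKer (d + 1) (Fib d) :=
  fun x y a b => slotW d M s * slotW d M t * lift M s t K x y a b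

/-- PIN: on the sublattice, in the `(inr, inr)` slots, the weighted lift reads the requested block times the two slot factors.
[folklore] -/
theorem liftW_zsmul (M : ℕ) [NeZero M] (s t : Bool) (K : ExpKernelCalculus.MKer (d + 1) (Fib d)) (x' y' : Fin (d + 1) → ℤ)
    (κ l : Fin (d + 1)) :
    liftW M s t K ((M : ℤ) • x') ((M : ℤ) • y') (Sum.inr κ) (Sum.inr l)
      = slotW d M s * slotW d M t * K x' y' (slot s κ) (slot t l) := by
  simp only [liftW, lift_zsmul]

/-- PIN: `liftW M false false = lift M false false` (no field slot, no factor). [folklore] -/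
theorem liftW_false_false (M : ℕ) (K : ExpKernelCalculus.MKer (d + 1) (Fib d)) :
    liftW M false false K = lift M false false K := by
  funext x y a b
  simp [liftW, slotW]

/-- PIN: the weighted lift vanishes when the left slot is a field slot. [folklore] -/
theorem liftW_inl_left (M : ℕ) (s t : Bool) (K : ExpKernelCalculus.MKer (d + 1) (Fib d)) (x y : Fin (d + 1) → ℤ)
    (κ : Fin (d + 1)) (b : Fib d) : liftW M s t K x y (Sum.inl κ) b = 0 := by
  simp only [liftW, lift_inl_left, mul_zero]

/-- PIN: the weighted lift vanishes when the right slot is a field slot. [folklore] -/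
theorem liftW_inl_right (M : ℕ) (s t : Bool) (K : ExpKernelCalculus.MKer (d + 1) (Fib d)) (x y : Fin (d + 1) → ℤ)
    (a : Fib d) (l : Fin (d + 1)) : liftW M s t K x y a (Sum.inl l) = 0 := by
  simp only [liftW, lift_inl_right, mul_zero]

/-- PIN: the weighted lift vanishes off the sublattice (either leg). [folklore] -/
theorem liftW_off (M : ℕ) (s t : Bool) (K : ExpKernelCalculus.MKer (d + 1) (Fib d)) {x y : Fin (d + 1) → ℤ}
    (h : Torus.proj M x ≠ 0 ∨ Torus.proj M y ≠ 0) (a b : Fib d) : liftW M s t K x y a b = 0 := by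
  simp only [liftW, lift_off M s t K h, mul_zero]

/-- **FINE-UNIT DECAY OF THE WEIGHTED LIFT**: rate `δ/M`, constant multiplied by the two slot factors. [folklore] -/
theorem decays_liftW (M : ℕ) [NeZero M] (s t : Bool) {K : ExpKernelCalculus.MKer (d + 1) (Fib d)} {C δ : ℝ}
    (hK : Decays K C δ) : Decays (liftW M s t K) (slotW d M s * slotW d M t * C) (δ / M) := by
  intro x y a b
  have h := decays_lift M s t hK x y a b
  simp only [liftW, abs_mul, abs_of_nonneg (slotW_nonneg d M s), abs_of_nonneg (slotW_nonneg d M t)]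
  rw [mul_assoc (slotW d M s * slotW d M t)]
  exact mul_le_mul_of_nonneg_left h (mul_nonneg (slotW_nonneg d M s) (slotW_nonneg d M t))

end LiftW

end Literature.MathematicalPhysics.QuantumFieldTheory.Balaban1983to89.Beta.InterLevelTransport

end
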